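import Mathlib.RingTheory.MvPolynomial.Homogeneous
import Mathlib.Algebra.Order.Group.MinMax
import Mathlib.Algebra.BigOperators.Fin
import Literature.Computability.AlgebraicComplexity.HrubesSensitiveMonotone
import Literature.Computability.AlgebraicComplexity.ArithCircuitProofs
import Literature.Computability.AlgebraicComplexity.GateQuotients
import HarnessLib

/-!
# Proof of Hrubeš's `ε`-sensitive monotone simulation theorem (`Hrubes2020_sensitive_holds`)

This sibling file of `HrubesSensitiveMonotone.lean` discharges the named fact
`Literature.Computability.AlgebraicComplexity.Hrubes2020_sensitive` (P. Hrubeš, *On ε-sensitive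
monotone computations*, Comput. Complexity 29 (2020) Art. 6 = ECCC TR19-034, §2 Theorem 1),
following the printed proof of §4 (Lemma 22, Lemma 23, "Theorem 1 (restated)"):

* **Lemma 23** (one subtraction + homogenization, "quite standard", proof omitted in print): a
  circuit of size `s` for `f` of degree `d` gives monotone `f₊`, `f₋` with `f = f₊ - f₋`, and the
  homogeneous parts `f₊^{(k)}`, `f₋^{(k)}`, `k ≤ d`, are simultaneously computable by a monotone
  circuit of size `O(s d²)` (gate by gate: a sum gate splits its coefficients by sign, a product
  gate is the Cauchy product of the homogeneous parts).
* **Lemma 22** (the main lemma): along a (syntactically) homogeneous monotone circuit every gate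
  `u` of degree `k` gets a constant `R_u ≥ 0` such that all `h_u := R_u L^k - û`, `L := Σ xᵢ`, are
  simultaneously monotone-computable with `O(1)` extra gates per gate: `h_{u₁+u₂} = h_{u₁} + h_{u₂}`
  (eq. (4)) and `h_{u₁ u₂} = h_{u₁} R_{u₂} L^{deg u₂} + û₁ h_{u₂}` (eq. (5)); the inputs need
  `L - x_j` for all `j` (print: `O(n log n)` by doubling; here `O(n)` by prefix and suffix sums)
  and the powers `L^k`.
* **Assembly**: with `R := Σ_k R_k` (constants of `f₋^{(k)}`),
  `R (L+1)^d + f = f₊ + (R (L+1)^d - Σ R_k L^k) + Σ (R_k L^k - f₋^{(k)})`, all three monotone, and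
  `ε₀ := R⁻¹` (here `(R+1)⁻¹`, allowing `R = 0`).

Formalization choices. The three constructions are fused into ONE pass over the gate list of
the given fan-in-two circuit over `ℝ` (the tree's `ArithCircuit ℝ (Fin n)`, attained size
`complexity f` by `ArithCircuit.exists_computes_size_eq_complexity`): for every gate value `v`
and every `k ≤ d` the pass makes available, in a growing list `gs` of plain fan-in-two gates over
`ℝ≥0` (Jerrum–Snir's monotone model `IsMonotoneComputation` of `MonotoneGap.lean`), polynomials
`a_k, b_k ∈ ℝ≥0[x]` with `v^{(k)} = a_k - b_k` (Lemma 23) together with their Lemma-22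
complements `qa_k + a_k = A_k L^k`, `qb_k + b_k = B_k L^k` (subtraction-free form over `ℝ≥0`).
The monotone program is only ever extended by appending one gate at the end
(`ArithCircuit.gateValues_append_singleton`), so earlier gate values persist and no
append/shift surgery is needed; everything else is semantic. All bookkeeping predicates are
written out (no auxiliary definitions): "`p` is available in `gs`" is
`∃ u : Operand, u.RefsBelow gs.length ∧ u.eval (gateValues gs) = p`, and "`gs` is a monotone
program" is `∀ g ∈ gs, g.fanIn ≤ 2 ∧ IsPlainGate g`. The final count is
`size ≤ 3n + 7d + 6 + 60 (d+1)² s ≤ 1000 (s d² + n ⌊log₂ n⌋ + 1)` (using `d = 0 ⇒ s = 0` and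
`s = 0 ⇒ d ≤ 1`), i.e. the printed `O(s d² + n log n)` with the `+1` of the vendored statement
(the constant `1000` is generous; nothing in the source fixes it).

Deliberately NOT here: the variants of §4.1 (Lemma 24, Proposition 25, multilinear /
`ΣΠΣ` / univariate versions) and the Boolean and proof-complexity parts of the paper.

## References

* [Hrubes2020] P. Hrubeš, *On ε-sensitive monotone computations*, Comput. Complexity 29 (2020)
  Art. 6; ECCC TR19-034, §4: Lemma 22 (eqs. (4), (5), items (i), (ii)), Lemma 23,
  Theorem 1 (restated) and its proof.
* [JerrumSnir1982] M. Jerrum, M. Snir, J. ACM 29 (1982), §2.2 (the monotone model).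
* [Burgisser2000] P. Bürgisser, *Completeness and Reduction in Algebraic Complexity Theory*,
  Def. 2.1 (the circuit model).
-/

noncomputable section

namespace Literature.Computability.AlgebraicComplexity

open MvPolynomial ArithCircuit Literature.Barriers.ValiantsHypothesis
open scoped NNReal

namespace Hrubes2020

universe u v

/-! ### Plumbing: growing a gate list at the end -/

section Plumbing

variable {k : Type u} [CommSemiring k] {σ : Type v}

/-- The value list of a prefix of a gate list is a prefix of the value list (values of earlier
gates never change when gates are appended). [cite: Burgisser2000, Def. 2.1] -/
theorem gateValues_prefix {gs gs' : List (Gate k σ)} (h : gs <+: gs') :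
    gateValues gs <+: gateValues gs' := by
  obtain ⟨t, rfl⟩ := h
  induction t using List.reverseRecOn with
  | nil => simp
  | append_singleton t g ih =>
    rw [← List.append_assoc, gateValues_append_singleton]
    exact ih.trans (List.prefix_append _ _)

/-- An operand referring below `vals.length` ignores appended values.
[cite: Burgisser2000, Def. 2.1] -/
theorem operand_eval_append {vals ws : List (MvPolynomial σ k)} {u : Operand k σ}
    (hu : u.RefsBelow vals.length) : u.eval (vals ++ ws) = u.eval vals := by
  cases u with
  | var i => rfl
  | const c => rfl
  | gate j =>
    simp only [Operand.RefsBelow] at hu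
    simp [Operand.eval, List.getD_eq_getElem?_getD, List.getElem?_append_left hu]

/-- An operand referring to gates of `gs` keeps its value when `gs` is extended.
[cite: Burgisser2000, Def. 2.1] -/
theorem operand_eval_of_prefix {gs gs' : List (Gate k σ)} (h : gs <+: gs') {u : Operand k σ}
    (hu : u.RefsBelow gs.length) : u.eval (gateValues gs') = u.eval (gateValues gs) := by
  obtain ⟨t, ht⟩ := gateValues_prefix h
  rw [← ht]
  apply operand_eval_append
  rwa [gateValues_length]

omit [CommSemiring k] in
/-- `RefsBelow` is monotone in the bound. [folklore] -/
theorem refsBelow_mono {u : Operand k σ} {m m' : ℕ} (h : m ≤ m') (hu : u.RefsBelow m) :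
    u.RefsBelow m' := by
  cases u with
  | var i => trivial
  | const c => trivial
  | gate j => exact lt_of_lt_of_le hu h

/-- Availability is monotone under extension of the gate list. [cite: Burgisser2000, Def. 2.1] -/
theorem avail_mono {gs gs' : List (Gate k σ)} (h : gs <+: gs') {p : MvPolynomial σ k}
    (hp : ∃ u : Operand k σ, u.RefsBelow gs.length ∧ u.eval (gateValues gs) = p) :
    ∃ u : Operand k σ, u.RefsBelow gs'.length ∧ u.eval (gateValues gs') = p := by
  obtain ⟨u, hu, rfl⟩ := hp
  exact ⟨u, refsBelow_mono h.length_le hu, operand_eval_of_prefix h hu⟩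

/-- Variables are available for free. [cite: Burgisser2000, Def. 2.1] -/
theorem avail_X (gs : List (Gate k σ)) (i : σ) :
    ∃ u : Operand k σ, u.RefsBelow gs.length ∧ u.eval (gateValues gs) = X i :=
  ⟨.var i, trivial, rfl⟩

/-- Constants are available for free. [cite: Burgisser2000, Def. 2.1] -/
theorem avail_C (gs : List (Gate k σ)) (c : k) :
    ∃ u : Operand k σ, u.RefsBelow gs.length ∧ u.eval (gateValues gs) = C c :=
  ⟨.const c, trivial, rfl⟩

/-- One plain addition gate appended at the end makes `p + q` available (Jerrum–Snir `⊕`-node).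
[cite: JerrumSnir1982, §2.2] -/
theorem extend_add {gs : List (Gate k σ)} {p q : MvPolynomial σ k}
    (hgs : ∀ g ∈ gs, g.fanIn ≤ 2 ∧ IsPlainGate g)
    (hp : ∃ u : Operand k σ, u.RefsBelow gs.length ∧ u.eval (gateValues gs) = p)
    (hq : ∃ u : Operand k σ, u.RefsBelow gs.length ∧ u.eval (gateValues gs) = q) :
    ∃ gs' : List (Gate k σ), gs <+: gs' ∧ (∀ g ∈ gs', g.fanIn ≤ 2 ∧ IsPlainGate g) ∧
      gs'.length ≤ gs.length + 1 ∧
      ∃ u : Operand k σ, u.RefsBelow gs'.length ∧ u.eval (gateValues gs') = p + q := by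
  obtain ⟨up, hup, rfl⟩ := hp
  obtain ⟨uq, huq, rfl⟩ := hq
  refine ⟨gs ++ [Gate.sum [(1, up), (1, uq)]], List.prefix_append _ _, ?_, by simp,
    .gate gs.length, ?_, ?_⟩
  · intro g hg
    rw [List.mem_append, List.mem_singleton] at hg
    rcases hg with hg | rfl
    · exact hgs g hg
    · exact ⟨by simp [Gate.fanIn, Gate.args], by simp [IsPlainGate]⟩
  · simp [Operand.RefsBelow]
  · rw [gateValues_append_singleton]
    have hl := gateValues_length (k := k) gs
    simp [Operand.eval, List.getD_eq_getElem?_getD, Gate.eval, hl]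

/-- One product gate appended at the end makes `p * q` available (Jerrum–Snir `⊗`-node).
[cite: JerrumSnir1982, §2.2] -/
theorem extend_mul {gs : List (Gate k σ)} {p q : MvPolynomial σ k}
    (hgs : ∀ g ∈ gs, g.fanIn ≤ 2 ∧ IsPlainGate g)
    (hp : ∃ u : Operand k σ, u.RefsBelow gs.length ∧ u.eval (gateValues gs) = p)
    (hq : ∃ u : Operand k σ, u.RefsBelow gs.length ∧ u.eval (gateValues gs) = q) :
    ∃ gs' : List (Gate k σ), gs <+: gs' ∧ (∀ g ∈ gs', g.fanIn ≤ 2 ∧ IsPlainGate g) ∧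
      gs'.length ≤ gs.length + 1 ∧
      ∃ u : Operand k σ, u.RefsBelow gs'.length ∧ u.eval (gateValues gs') = p * q := by
  obtain ⟨up, hup, rfl⟩ := hp
  obtain ⟨uq, huq, rfl⟩ := hq
  refine ⟨gs ++ [Gate.prod [up, uq]], List.prefix_append _ _, ?_, by simp,
    .gate gs.length, ?_, ?_⟩
  · intro g hg
    rw [List.mem_append, List.mem_singleton] at hg
    rcases hg with hg | rfl
    · exact hgs g hg
    · exact ⟨by simp [Gate.fanIn, Gate.args], by simp [IsPlainGate]⟩
  · simp [Operand.RefsBelow]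
  · rw [gateValues_append_singleton]
    have hl := gateValues_length (k := k) gs
    simp [Operand.eval, List.getD_eq_getElem?_getD, Gate.eval, hl]

/-- Scalar multiplication by a constant is a product gate with a constant operand (constants
enter Jerrum–Snir computations as inputs). [cite: JerrumSnir1982, §2.2] -/
theorem extend_smul {gs : List (Gate k σ)} (c : k) {p : MvPolynomial σ k}
    (hgs : ∀ g ∈ gs, g.fanIn ≤ 2 ∧ IsPlainGate g)
    (hp : ∃ u : Operand k σ, u.RefsBelow gs.length ∧ u.eval (gateValues gs) = p) :
    ∃ gs' : List (Gate k σ), gs <+: gs' ∧ (∀ g ∈ gs', g.fanIn ≤ 2 ∧ IsPlainGate g) ∧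
      gs'.length ≤ gs.length + 1 ∧
      ∃ u : Operand k σ, u.RefsBelow gs'.length ∧ u.eval (gateValues gs') = C c * p :=
  extend_mul hgs (avail_C gs c) hp

/-- Sequential iteration of extension steps: if, for every `l < m`, any good extension in which
the earlier targets `Q l'`, `l' < l`, hold can be extended by at most `cost` gates to one in
which `Q l` holds, and the `Q l` are monotone under extension, then `cost * m` gates make all
`Q l`, `l < m`, hold simultaneously. [folklore] -/
theorem iterate_extend (Q : ℕ → List (Gate k σ) → Prop)
    (hQ : ∀ l (gs₁ gs₂ : List (Gate k σ)), gs₁ <+: gs₂ → Q l gs₁ → Q l gs₂) (cost : ℕ)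
    (gs : List (Gate k σ)) (hgs : ∀ g ∈ gs, g.fanIn ≤ 2 ∧ IsPlainGate g) :
    ∀ m : ℕ,
    (∀ l < m, ∀ gs' : List (Gate k σ), gs <+: gs' → (∀ g ∈ gs', g.fanIn ≤ 2 ∧ IsPlainGate g) →
      (∀ l' < l, Q l' gs') →
      ∃ gs'' : List (Gate k σ), gs' <+: gs'' ∧ (∀ g ∈ gs'', g.fanIn ≤ 2 ∧ IsPlainGate g) ∧
        gs''.length ≤ gs'.length + cost ∧ Q l gs'') →
    ∃ gs' : List (Gate k σ), gs <+: gs' ∧ (∀ g ∈ gs', g.fanIn ≤ 2 ∧ IsPlainGate g) ∧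
      gs'.length ≤ gs.length + cost * m ∧ ∀ l < m, Q l gs' := by
  intro m
  induction m with
  | zero =>
    intro _
    exact ⟨gs, List.prefix_rfl, hgs, by simp, fun l hl => absurd hl (Nat.not_lt_zero l)⟩
  | succ m ih =>
    intro h
    obtain ⟨gs₁, hpre₁, hgood₁, hlen₁, hQ₁⟩ :=
      ih fun l hl gs' hp hg hQ' => h l (Nat.lt_succ_of_lt hl) gs' hp hg hQ'
    obtain ⟨gs₂, hpre₂, hgood₂, hlen₂, hQ₂⟩ := h m (Nat.lt_succ_self m) gs₁ hpre₁ hgood₁ hQ₁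
    refine ⟨gs₂, hpre₁.trans hpre₂, hgood₂, ?_, fun l hl => ?_⟩
    · rw [Nat.mul_succ]; omega
    · rcases Nat.lt_succ_iff_lt_or_eq.mp hl with hl | rfl
      · exact hQ l gs₁ gs₂ hpre₂ (hQ₁ l hl)
      · exact hQ₂

/-- Accumulating a sum `∑_{l < m} t l` of terms each of which can be made available with at
most `cost` gates: `(cost + 1) * m` gates. [folklore] -/
theorem avail_sum_range (t : ℕ → MvPolynomial σ k) (cost : ℕ)
    (gs : List (Gate k σ)) (hgs : ∀ g ∈ gs, g.fanIn ≤ 2 ∧ IsPlainGate g) :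
    ∀ m : ℕ,
    (∀ l < m, ∀ gs' : List (Gate k σ), gs <+: gs' → (∀ g ∈ gs', g.fanIn ≤ 2 ∧ IsPlainGate g) →
      ∃ gs'' : List (Gate k σ), gs' <+: gs'' ∧ (∀ g ∈ gs'', g.fanIn ≤ 2 ∧ IsPlainGate g) ∧
        gs''.length ≤ gs'.length + cost ∧
        ∃ u : Operand k σ, u.RefsBelow gs''.length ∧ u.eval (gateValues gs'') = t l) →
    ∃ gs' : List (Gate k σ), gs <+: gs' ∧ (∀ g ∈ gs', g.fanIn ≤ 2 ∧ IsPlainGate g) ∧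
      gs'.length ≤ gs.length + (cost + 1) * m ∧
      ∃ u : Operand k σ, u.RefsBelow gs'.length ∧
        u.eval (gateValues gs') = ∑ l ∈ Finset.range m, t l := by
  intro m
  induction m with
  | zero =>
    intro _
    refine ⟨gs, List.prefix_rfl, hgs, by simp, ?_⟩
    simpa using avail_C gs (0 : k)
  | succ m ih =>
    intro h
    obtain ⟨gs₁, hpre₁, hgood₁, hlen₁, hS⟩ :=
      ih fun l hl gs' hp hg => h l (Nat.lt_succ_of_lt hl) gs' hp hg
    obtain ⟨gs₂, hpre₂, hgood₂, hlen₂, ht⟩ := h m (Nat.lt_succ_self m) gs₁ hpre₁ hgood₁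
    obtain ⟨gs₃, hpre₃, hgood₃, hlen₃, hu⟩ := extend_add hgood₂ (avail_mono hpre₂ hS) ht
    refine ⟨gs₃, hpre₁.trans (hpre₂.trans hpre₃), hgood₃, ?_, ?_⟩
    · rw [Nat.mul_succ]; omega
    · simpa [Finset.sum_range_succ] using hu

/-- Componentwise binary operations on two lists of available polynomials: if one gate makes
`op p q` available from `p` and `q`, then `ps.length` gates make all `op psᵢ qsᵢ` available.
[folklore] -/
theorem avail_zipWith (op : MvPolynomial σ k → MvPolynomial σ k → MvPolynomial σ k)
    (hop : ∀ (gs : List (Gate k σ)) (p q : MvPolynomial σ k),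
      (∀ g ∈ gs, g.fanIn ≤ 2 ∧ IsPlainGate g) →
      (∃ u : Operand k σ, u.RefsBelow gs.length ∧ u.eval (gateValues gs) = p) →
      (∃ u : Operand k σ, u.RefsBelow gs.length ∧ u.eval (gateValues gs) = q) →
      ∃ gs' : List (Gate k σ), gs <+: gs' ∧ (∀ g ∈ gs', g.fanIn ≤ 2 ∧ IsPlainGate g) ∧
        gs'.length ≤ gs.length + 1 ∧
        ∃ u : Operand k σ, u.RefsBelow gs'.length ∧ u.eval (gateValues gs') = op p q) :
    ∀ (ps qs : List (MvPolynomial σ k)) (gs : List (Gate k σ)),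
    (∀ g ∈ gs, g.fanIn ≤ 2 ∧ IsPlainGate g) →
    (∀ p ∈ ps, ∃ u : Operand k σ, u.RefsBelow gs.length ∧ u.eval (gateValues gs) = p) →
    (∀ q ∈ qs, ∃ u : Operand k σ, u.RefsBelow gs.length ∧ u.eval (gateValues gs) = q) →
    ∃ gs' : List (Gate k σ), gs <+: gs' ∧ (∀ g ∈ gs', g.fanIn ≤ 2 ∧ IsPlainGate g) ∧
      gs'.length ≤ gs.length + ps.length ∧
      ∀ r ∈ List.zipWith op ps qs,
        ∃ u : Operand k σ, u.RefsBelow gs'.length ∧ u.eval (gateValues gs') = r := by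
  intro ps
  induction ps with
  | nil =>
    intro qs gs hgs _ _
    exact ⟨gs, List.prefix_rfl, hgs, by simp, fun r hr => by simp at hr⟩
  | cons p ps ih =>
    intro qs gs hgs hps hqs
    cases qs with
    | nil => exact ⟨gs, List.prefix_rfl, hgs, by simp, fun r hr => by simp at hr⟩
    | cons q qs =>
      obtain ⟨gs₁, hpre₁, hgood₁, hlen₁, hu₁⟩ :=
        hop gs p q hgs (hps p (by simp)) (hqs q (by simp))
      obtain ⟨gs₂, hpre₂, hgood₂, hlen₂, hall⟩ := ih qs gs₁ hgood₁
        (fun p' hp' => avail_mono hpre₁ (hps p' (by simp [hp'])))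
        (fun q' hq' => avail_mono hpre₁ (hqs q' (by simp [hq'])))
      refine ⟨gs₂, hpre₁.trans hpre₂, hgood₂, ?_, ?_⟩
      · simp only [List.length_cons]; omega
      · intro r hr
        simp only [List.zipWith_cons_cons, List.mem_cons] at hr
        rcases hr with rfl | hr
        · exact avail_mono hpre₂ hu₁
        · exact hall r hr

end Plumbing

/-! ### Lemma 22's complements: the gadgets of eqs. (4) and (5) -/

section Complements

variable {n : ℕ}

/-- Eq. (5) of Lemma 22 in subtraction-free form: if `qp + p = P L^i` and `qq + q = Q L^j` then
`(qp (Q L^j) + p qq) + p q = (P Q) L^{i+j}`. [cite: Hrubes2020, §4 Lemma 22 (eq. (5))] -/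
theorem compl_mul_eq {R : Type u} [CommSemiring R] {p qp q qq P Q L : R} {i j : ℕ}
    (hp : qp + p = P * L ^ i) (hq : qq + q = Q * L ^ j) :
    (qp * (Q * L ^ j) + p * qq) + p * q = (P * Q) * L ^ (i + j) := by
  calc (qp * (Q * L ^ j) + p * qq) + p * q = qp * (Q * L ^ j) + p * (qq + q) := by ring
    _ = (qp + p) * (Q * L ^ j) := by rw [hq]; ring
    _ = (P * Q) * L ^ (i + j) := by rw [hp]; ring

/-- Eq. (4) of Lemma 22 in subtraction-free form: complements add.
[cite: Hrubes2020, §4 Lemma 22 (eq. (4))] -/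
theorem compl_add_eq {R : Type u} [CommSemiring R] {p qp q qq P Q M : R}
    (hp : qp + p = P * M) (hq : qq + q = Q * M) :
    (qp + qq) + (p + q) = (P + Q) * M := by
  calc (qp + qq) + (p + q) = (qp + p) + (qq + q) := by ring
    _ = (P + Q) * M := by rw [hp, hq]; ring

/-- Scaling a complement pair by a nonnegative constant. [cite: Hrubes2020, §4 Lemma 22] -/
theorem compl_smul_eq {R : Type u} [CommSemiring R] {p qp P M : R} (c : R)
    (hp : qp + p = P * M) : c * qp + c * p = (c * P) * M := by
  rw [← mul_add, hp]; ring

/-- The product gadget of eq. (5): from available `p, qp, q, qq` and the power `L^j`, five gates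
make `p q` and the complement `qp (Q L^j) + p qq` available.
[cite: Hrubes2020, §4 Lemma 22 (eq. (5))] -/
theorem gadget_mul {gs : List (Gate ℝ≥0 (Fin n))} {p qp q qq Lj : MvPolynomial (Fin n) ℝ≥0}
    (Q : ℝ≥0) (hgs : ∀ g ∈ gs, g.fanIn ≤ 2 ∧ IsPlainGate g)
    (hp : ∃ u : Operand ℝ≥0 (Fin n), u.RefsBelow gs.length ∧ u.eval (gateValues gs) = p)
    (hqp : ∃ u : Operand ℝ≥0 (Fin n), u.RefsBelow gs.length ∧ u.eval (gateValues gs) = qp)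
    (hq : ∃ u : Operand ℝ≥0 (Fin n), u.RefsBelow gs.length ∧ u.eval (gateValues gs) = q)
    (hqq : ∃ u : Operand ℝ≥0 (Fin n), u.RefsBelow gs.length ∧ u.eval (gateValues gs) = qq)
    (hL : ∃ u : Operand ℝ≥0 (Fin n), u.RefsBelow gs.length ∧ u.eval (gateValues gs) = Lj) :
    ∃ gs' : List (Gate ℝ≥0 (Fin n)), gs <+: gs' ∧ (∀ g ∈ gs', g.fanIn ≤ 2 ∧ IsPlainGate g) ∧
      gs'.length ≤ gs.length + 5 ∧
      (∃ u : Operand ℝ≥0 (Fin n), u.RefsBelow gs'.length ∧ u.eval (gateValues gs') = p * q) ∧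
      (∃ u : Operand ℝ≥0 (Fin n), u.RefsBelow gs'.length ∧
        u.eval (gateValues gs') = qp * (C Q * Lj) + p * qq) := by
  obtain ⟨gs₁, hpre₁, hgood₁, hlen₁, h₁⟩ := extend_mul hgs hp hq
  obtain ⟨gs₂, hpre₂, hgood₂, hlen₂, h₂⟩ := extend_smul Q hgood₁ (avail_mono hpre₁ hL)
  have hpre₀₂ := hpre₁.trans hpre₂
  obtain ⟨gs₃, hpre₃, hgood₃, hlen₃, h₃⟩ := extend_mul hgood₂ (avail_mono hpre₀₂ hqp) h₂
  have hpre₀₃ := hpre₀₂.trans hpre₃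
  obtain ⟨gs₄, hpre₄, hgood₄, hlen₄, h₄⟩ :=
    extend_mul hgood₃ (avail_mono hpre₀₃ hp) (avail_mono hpre₀₃ hqq)
  obtain ⟨gs₅, hpre₅, hgood₅, hlen₅, h₅⟩ := extend_add hgood₄ (avail_mono hpre₄ h₃) h₄
  refine ⟨gs₅, hpre₀₃.trans (hpre₄.trans hpre₅), hgood₅, by omega, ?_, h₅⟩
  exact avail_mono (hpre₂.trans (hpre₃.trans (hpre₄.trans hpre₅))) h₁

end Complements

/-! ### Lemma 23 fused with Lemma 22: sign-split homogeneous parts with complements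

For a gate value `v ∈ ℝ[x]` of the general circuit, "`v` is `d`-represented in `gs`" means:
there are `a_k, qa_k, b_k, qb_k ∈ ℝ≥0[x]` available in `gs` and constants `A_k, B_k ≥ 0` with
`v^{(k)} = a_k - b_k`, `qa_k + a_k = A_k L^k`, `qb_k + b_k = B_k L^k` for all `k ≤ d`
(written out in full in every statement below). -/

section Representation

variable {n : ℕ}

/-- Representations persist under extension of the monotone program. [cite: Hrubes2020, §4] -/
theorem repr_mono {gs gs' : List (Gate ℝ≥0 (Fin n))} (h : gs <+: gs') {d : ℕ}
    {v : MvPolynomial (Fin n) ℝ}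
    (hv : ∃ (a qa b qb : ℕ → MvPolynomial (Fin n) ℝ≥0) (A B : ℕ → ℝ≥0), ∀ k ≤ d,
      (∃ u : Operand ℝ≥0 (Fin n), u.RefsBelow gs.length ∧ u.eval (gateValues gs) = a k) ∧
      (∃ u : Operand ℝ≥0 (Fin n), u.RefsBelow gs.length ∧ u.eval (gateValues gs) = qa k) ∧
      qa k + a k = C (A k) * (∑ i, X i) ^ k ∧
      (∃ u : Operand ℝ≥0 (Fin n), u.RefsBelow gs.length ∧ u.eval (gateValues gs) = b k) ∧
      (∃ u : Operand ℝ≥0 (Fin n), u.RefsBelow gs.length ∧ u.eval (gateValues gs) = qb k) ∧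
      qb k + b k = C (B k) * (∑ i, X i) ^ k ∧
      homogeneousComponent k v = map NNReal.toRealHom (a k) - map NNReal.toRealHom (b k)) :
    ∃ (a qa b qb : ℕ → MvPolynomial (Fin n) ℝ≥0) (A B : ℕ → ℝ≥0), ∀ k ≤ d,
      (∃ u : Operand ℝ≥0 (Fin n), u.RefsBelow gs'.length ∧ u.eval (gateValues gs') = a k) ∧
      (∃ u : Operand ℝ≥0 (Fin n), u.RefsBelow gs'.length ∧ u.eval (gateValues gs') = qa k) ∧
      qa k + a k = C (A k) * (∑ i, X i) ^ k ∧
      (∃ u : Operand ℝ≥0 (Fin n), u.RefsBelow gs'.length ∧ u.eval (gateValues gs') = b k) ∧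
      (∃ u : Operand ℝ≥0 (Fin n), u.RefsBelow gs'.length ∧ u.eval (gateValues gs') = qb k) ∧
      qb k + b k = C (B k) * (∑ i, X i) ^ k ∧
      homogeneousComponent k v = map NNReal.toRealHom (a k) - map NNReal.toRealHom (b k) := by
  obtain ⟨a, qa, b, qb, A, B, hv⟩ := hv
  refine ⟨a, qa, b, qb, A, B, fun k hk => ?_⟩
  obtain ⟨h1, h2, h3, h4, h5, h6, h7⟩ := hv k hk
  exact ⟨avail_mono h h1, avail_mono h h2, h3, avail_mono h h4, avail_mono h h5, h6, h7⟩

/-- The zero polynomial is represented for free. [cite: Hrubes2020, §4 Lemma 22] -/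
theorem repr_zero (gs : List (Gate ℝ≥0 (Fin n))) (d : ℕ) :
    ∃ (a qa b qb : ℕ → MvPolynomial (Fin n) ℝ≥0) (A B : ℕ → ℝ≥0), ∀ k ≤ d,
      (∃ u : Operand ℝ≥0 (Fin n), u.RefsBelow gs.length ∧ u.eval (gateValues gs) = a k) ∧
      (∃ u : Operand ℝ≥0 (Fin n), u.RefsBelow gs.length ∧ u.eval (gateValues gs) = qa k) ∧
      qa k + a k = C (A k) * (∑ i, X i) ^ k ∧
      (∃ u : Operand ℝ≥0 (Fin n), u.RefsBelow gs.length ∧ u.eval (gateValues gs) = b k) ∧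
      (∃ u : Operand ℝ≥0 (Fin n), u.RefsBelow gs.length ∧ u.eval (gateValues gs) = qb k) ∧
      qb k + b k = C (B k) * (∑ i, X i) ^ k ∧
      homogeneousComponent k (0 : MvPolynomial (Fin n) ℝ) =
        map NNReal.toRealHom (a k) - map NNReal.toRealHom (b k) := by
  have h0 : ∃ u : Operand ℝ≥0 (Fin n), u.RefsBelow gs.length ∧ u.eval (gateValues gs) = 0 := by
    simpa using avail_C gs (0 : ℝ≥0)
  refine ⟨fun _ => 0, fun _ => 0, fun _ => 0, fun _ => 0, fun _ => 0, fun _ => 0,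
    fun k _ => ⟨h0, h0, by simp, h0, h0, by simp, by simp⟩⟩

/-- Input gates, constants (Lemma 22: "`R_u = u` if `u` is a constant ... `h_u = 0`"; Lemma 23:
a negative constant goes to `f₋`): `C c` is represented for free, with `a₀ = max(c,0)`,
`b₀ = max(-c,0)` and vanishing complements. [cite: Hrubes2020, §4 Lemma 22] -/
theorem repr_C (gs : List (Gate ℝ≥0 (Fin n))) (d : ℕ) (c : ℝ) :
    ∃ (a qa b qb : ℕ → MvPolynomial (Fin n) ℝ≥0) (A B : ℕ → ℝ≥0), ∀ k ≤ d,
      (∃ u : Operand ℝ≥0 (Fin n), u.RefsBelow gs.length ∧ u.eval (gateValues gs) = a k) ∧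
      (∃ u : Operand ℝ≥0 (Fin n), u.RefsBelow gs.length ∧ u.eval (gateValues gs) = qa k) ∧
      qa k + a k = C (A k) * (∑ i, X i) ^ k ∧
      (∃ u : Operand ℝ≥0 (Fin n), u.RefsBelow gs.length ∧ u.eval (gateValues gs) = b k) ∧
      (∃ u : Operand ℝ≥0 (Fin n), u.RefsBelow gs.length ∧ u.eval (gateValues gs) = qb k) ∧
      qb k + b k = C (B k) * (∑ i, X i) ^ k ∧
      homogeneousComponent k (C c : MvPolynomial (Fin n) ℝ) =
        map NNReal.toRealHom (a k) - map NNReal.toRealHom (b k) := by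
  have h0 : ∃ u : Operand ℝ≥0 (Fin n), u.RefsBelow gs.length ∧ u.eval (gateValues gs) = 0 := by
    simpa using avail_C gs (0 : ℝ≥0)
  refine ⟨fun k => if k = 0 then C c.toNNReal else 0, fun _ => 0,
    fun k => if k = 0 then C (-c).toNNReal else 0, fun _ => 0,
    fun k => if k = 0 then c.toNNReal else 0, fun k => if k = 0 then (-c).toNNReal else 0,
    fun k _ => ?_⟩
  dsimp only
  by_cases hk : k = 0
  · subst hk
    refine ⟨by simpa using avail_C gs c.toNNReal, h0, by simp,
      by simpa using avail_C gs (-c).toNNReal, h0, by simp, ?_⟩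
    rw [homogeneousComponent_of_mem (isHomogeneous_C (Fin n) c), if_pos rfl, if_pos rfl,
      if_pos rfl, map_C, map_C, ← C_sub]
    congr 1
    simp [Real.coe_toNNReal']
  · refine ⟨by simpa [hk] using h0, h0, by simp [hk], by simpa [hk] using h0, h0, by simp [hk],
      ?_⟩
    rw [homogeneousComponent_of_mem (isHomogeneous_C (Fin n) c)]
    simp [hk]

/-- Input gates, variables (Lemma 22: "`R_u = 1` if `u` is a variable `x_j` ... `h_u = L - x_j`"):
given the complements `L - x_i` (precomputed), `X i` is represented for free.
[cite: Hrubes2020, §4 Lemma 22] -/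
theorem repr_X (gs : List (Gate ℝ≥0 (Fin n))) (d : ℕ)
    (hLm : ∀ i : Fin n, ∃ u : Operand ℝ≥0 (Fin n), u.RefsBelow gs.length ∧
      u.eval (gateValues gs) + X i = ∑ i', X i')
    (i : Fin n) :
    ∃ (a qa b qb : ℕ → MvPolynomial (Fin n) ℝ≥0) (A B : ℕ → ℝ≥0), ∀ k ≤ d,
      (∃ u : Operand ℝ≥0 (Fin n), u.RefsBelow gs.length ∧ u.eval (gateValues gs) = a k) ∧
      (∃ u : Operand ℝ≥0 (Fin n), u.RefsBelow gs.length ∧ u.eval (gateValues gs) = qa k) ∧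
      qa k + a k = C (A k) * (∑ i, X i) ^ k ∧
      (∃ u : Operand ℝ≥0 (Fin n), u.RefsBelow gs.length ∧ u.eval (gateValues gs) = b k) ∧
      (∃ u : Operand ℝ≥0 (Fin n), u.RefsBelow gs.length ∧ u.eval (gateValues gs) = qb k) ∧
      qb k + b k = C (B k) * (∑ i, X i) ^ k ∧
      homogeneousComponent k (X i : MvPolynomial (Fin n) ℝ) =
        map NNReal.toRealHom (a k) - map NNReal.toRealHom (b k) := by
  have h0 : ∃ u : Operand ℝ≥0 (Fin n), u.RefsBelow gs.length ∧ u.eval (gateValues gs) = 0 := by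
    simpa using avail_C gs (0 : ℝ≥0)
  obtain ⟨uq, huq, hq⟩ := hLm i
  refine ⟨fun k => if k = 1 then X i else 0, fun k => if k = 1 then uq.eval (gateValues gs) else 0,
    fun _ => 0, fun _ => 0, fun k => if k = 1 then 1 else 0, fun _ => 0,
    fun k _ => ?_⟩
  dsimp only
  by_cases hk : k = 1
  · subst hk
    refine ⟨by simpa using avail_X gs i, ⟨uq, huq, by simp⟩, by simpa using hq, h0, h0, by simp,
      ?_⟩
    rw [homogeneousComponent_of_mem (isHomogeneous_X ℝ i)]
    simp
  · refine ⟨by simpa [hk] using h0, by simpa [hk] using h0, by simp [hk], h0, h0, by simp, ?_⟩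
    rw [homogeneousComponent_of_mem (isHomogeneous_X ℝ i)]
    simp [hk]

/-- Sum gates, unweighted part (Lemma 23: `(v+w)₊ = v₊ + w₊`, `(v+w)₋ = v₋ + w₋` degree by degree;
Lemma 22 eq. (4): complements add): `4 (d+1)` gates. [cite: Hrubes2020, §4 Lemma 22 (eq. (4))] -/
theorem repr_add {gs : List (Gate ℝ≥0 (Fin n))} (hgs : ∀ g ∈ gs, g.fanIn ≤ 2 ∧ IsPlainGate g)
    {d : ℕ} {v w : MvPolynomial (Fin n) ℝ}
    (hv : ∃ (a qa b qb : ℕ → MvPolynomial (Fin n) ℝ≥0) (A B : ℕ → ℝ≥0), ∀ k ≤ d,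
      (∃ u : Operand ℝ≥0 (Fin n), u.RefsBelow gs.length ∧ u.eval (gateValues gs) = a k) ∧
      (∃ u : Operand ℝ≥0 (Fin n), u.RefsBelow gs.length ∧ u.eval (gateValues gs) = qa k) ∧
      qa k + a k = C (A k) * (∑ i, X i) ^ k ∧
      (∃ u : Operand ℝ≥0 (Fin n), u.RefsBelow gs.length ∧ u.eval (gateValues gs) = b k) ∧
      (∃ u : Operand ℝ≥0 (Fin n), u.RefsBelow gs.length ∧ u.eval (gateValues gs) = qb k) ∧
      qb k + b k = C (B k) * (∑ i, X i) ^ k ∧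
      homogeneousComponent k v = map NNReal.toRealHom (a k) - map NNReal.toRealHom (b k))
    (hw : ∃ (a qa b qb : ℕ → MvPolynomial (Fin n) ℝ≥0) (A B : ℕ → ℝ≥0), ∀ k ≤ d,
      (∃ u : Operand ℝ≥0 (Fin n), u.RefsBelow gs.length ∧ u.eval (gateValues gs) = a k) ∧
      (∃ u : Operand ℝ≥0 (Fin n), u.RefsBelow gs.length ∧ u.eval (gateValues gs) = qa k) ∧
      qa k + a k = C (A k) * (∑ i, X i) ^ k ∧
      (∃ u : Operand ℝ≥0 (Fin n), u.RefsBelow gs.length ∧ u.eval (gateValues gs) = b k) ∧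
      (∃ u : Operand ℝ≥0 (Fin n), u.RefsBelow gs.length ∧ u.eval (gateValues gs) = qb k) ∧
      qb k + b k = C (B k) * (∑ i, X i) ^ k ∧
      homogeneousComponent k w = map NNReal.toRealHom (a k) - map NNReal.toRealHom (b k)) :
    ∃ gs' : List (Gate ℝ≥0 (Fin n)), gs <+: gs' ∧ (∀ g ∈ gs', g.fanIn ≤ 2 ∧ IsPlainGate g) ∧
      gs'.length ≤ gs.length + 4 * (d + 1) ∧
    ∃ (a qa b qb : ℕ → MvPolynomial (Fin n) ℝ≥0) (A B : ℕ → ℝ≥0), ∀ k ≤ d,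
      (∃ u : Operand ℝ≥0 (Fin n), u.RefsBelow gs'.length ∧ u.eval (gateValues gs') = a k) ∧
      (∃ u : Operand ℝ≥0 (Fin n), u.RefsBelow gs'.length ∧ u.eval (gateValues gs') = qa k) ∧
      qa k + a k = C (A k) * (∑ i, X i) ^ k ∧
      (∃ u : Operand ℝ≥0 (Fin n), u.RefsBelow gs'.length ∧ u.eval (gateValues gs') = b k) ∧
      (∃ u : Operand ℝ≥0 (Fin n), u.RefsBelow gs'.length ∧ u.eval (gateValues gs') = qb k) ∧
      qb k + b k = C (B k) * (∑ i, X i) ^ k ∧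
      homogeneousComponent k (v + w) =
        map NNReal.toRealHom (a k) - map NNReal.toRealHom (b k) := by
  obtain ⟨a₁, qa₁, b₁, qb₁, A₁, B₁, h₁⟩ := hv
  obtain ⟨a₂, qa₂, b₂, qb₂, A₂, B₂, h₂⟩ := hw
  obtain ⟨gs', hpre, hgood, hlen, hall⟩ := iterate_extend
    (Q := fun l gs' =>
      (∃ u : Operand ℝ≥0 (Fin n), u.RefsBelow gs'.length ∧
        u.eval (gateValues gs') = a₁ l + a₂ l) ∧
      (∃ u : Operand ℝ≥0 (Fin n), u.RefsBelow gs'.length ∧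
        u.eval (gateValues gs') = qa₁ l + qa₂ l) ∧
      (∃ u : Operand ℝ≥0 (Fin n), u.RefsBelow gs'.length ∧
        u.eval (gateValues gs') = b₁ l + b₂ l) ∧
      (∃ u : Operand ℝ≥0 (Fin n), u.RefsBelow gs'.length ∧
        u.eval (gateValues gs') = qb₁ l + qb₂ l))
    (fun l gs₁ gs₂ h hQ => ⟨avail_mono h hQ.1, avail_mono h hQ.2.1, avail_mono h hQ.2.2.1,
      avail_mono h hQ.2.2.2⟩)
    4 gs hgs (d + 1) (by
      intro l hl gs' hp hg _
      obtain ⟨e1, e2, -, e4, e5, -, -⟩ := h₁ l (by omega)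
      obtain ⟨f1, f2, -, f4, f5, -, -⟩ := h₂ l (by omega)
      obtain ⟨gs'', hp'', hg'', hl'', hz⟩ := avail_zipWith (· + ·) (fun gs p q => extend_add)
        [a₁ l, qa₁ l, b₁ l, qb₁ l] [a₂ l, qa₂ l, b₂ l, qb₂ l] gs' hg
        (by
          intro p hp'
          simp only [List.mem_cons, List.not_mem_nil, or_false] at hp'
          rcases hp' with rfl | rfl | rfl | rfl
          · exact avail_mono hp e1
          · exact avail_mono hp e2
          · exact avail_mono hp e4
          · exact avail_mono hp e5)
        (by
          intro p hp'
          simp only [List.mem_cons, List.not_mem_nil, or_false] at hp'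
          rcases hp' with rfl | rfl | rfl | rfl
          · exact avail_mono hp f1
          · exact avail_mono hp f2
          · exact avail_mono hp f4
          · exact avail_mono hp f5)
      exact ⟨gs'', hp'', hg'', by simpa using hl'', hz _ (by simp), hz _ (by simp), hz _ (by simp),
        hz _ (by simp)⟩)
  refine ⟨gs', hpre, hgood, hlen, fun k => a₁ k + a₂ k, fun k => qa₁ k + qa₂ k,
    fun k => b₁ k + b₂ k, fun k => qb₁ k + qb₂ k, fun k => A₁ k + A₂ k, fun k => B₁ k + B₂ k,
    fun k hk => ?_⟩
  obtain ⟨-, -, e3, -, -, e6, e7⟩ := h₁ k hk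
  obtain ⟨-, -, f3, -, -, f6, f7⟩ := h₂ k hk
  obtain ⟨g1, g2, g4, g5⟩ := hall k (by omega)
  refine ⟨g1, g2, ?_, g4, g5, ?_, ?_⟩
  · rw [map_add]; exact compl_add_eq e3 f3
  · rw [map_add]; exact compl_add_eq e6 f6
  · rw [map_add, e7, f7, map_add, map_add]; ring

/-- Sum gates, weights (Lemma 23: a coefficient `c = c₊ - c₋` sends `c₊ v₊ + c₋ v₋` to the
positive and `c₊ v₋ + c₋ v₊` to the negative part; Lemma 22: complements scale): `12 (d+1)`
gates. [cite: Hrubes2020, §4 Lemma 23] -/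
theorem repr_smul {gs : List (Gate ℝ≥0 (Fin n))} (hgs : ∀ g ∈ gs, g.fanIn ≤ 2 ∧ IsPlainGate g)
    {d : ℕ} (c : ℝ) {v : MvPolynomial (Fin n) ℝ}
    (hv : ∃ (a qa b qb : ℕ → MvPolynomial (Fin n) ℝ≥0) (A B : ℕ → ℝ≥0), ∀ k ≤ d,
      (∃ u : Operand ℝ≥0 (Fin n), u.RefsBelow gs.length ∧ u.eval (gateValues gs) = a k) ∧
      (∃ u : Operand ℝ≥0 (Fin n), u.RefsBelow gs.length ∧ u.eval (gateValues gs) = qa k) ∧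
      qa k + a k = C (A k) * (∑ i, X i) ^ k ∧
      (∃ u : Operand ℝ≥0 (Fin n), u.RefsBelow gs.length ∧ u.eval (gateValues gs) = b k) ∧
      (∃ u : Operand ℝ≥0 (Fin n), u.RefsBelow gs.length ∧ u.eval (gateValues gs) = qb k) ∧
      qb k + b k = C (B k) * (∑ i, X i) ^ k ∧
      homogeneousComponent k v = map NNReal.toRealHom (a k) - map NNReal.toRealHom (b k)) :
    ∃ gs' : List (Gate ℝ≥0 (Fin n)), gs <+: gs' ∧ (∀ g ∈ gs', g.fanIn ≤ 2 ∧ IsPlainGate g) ∧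
      gs'.length ≤ gs.length + 12 * (d + 1) ∧
    ∃ (a qa b qb : ℕ → MvPolynomial (Fin n) ℝ≥0) (A B : ℕ → ℝ≥0), ∀ k ≤ d,
      (∃ u : Operand ℝ≥0 (Fin n), u.RefsBelow gs'.length ∧ u.eval (gateValues gs') = a k) ∧
      (∃ u : Operand ℝ≥0 (Fin n), u.RefsBelow gs'.length ∧ u.eval (gateValues gs') = qa k) ∧
      qa k + a k = C (A k) * (∑ i, X i) ^ k ∧
      (∃ u : Operand ℝ≥0 (Fin n), u.RefsBelow gs'.length ∧ u.eval (gateValues gs') = b k) ∧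
      (∃ u : Operand ℝ≥0 (Fin n), u.RefsBelow gs'.length ∧ u.eval (gateValues gs') = qb k) ∧
      qb k + b k = C (B k) * (∑ i, X i) ^ k ∧
      homogeneousComponent k (c • v) =
        map NNReal.toRealHom (a k) - map NNReal.toRealHom (b k) := by
  obtain ⟨a₁, qa₁, b₁, qb₁, A₁, B₁, h₁⟩ := hv
  set cp : ℝ≥0 := c.toNNReal with hcp
  set cm : ℝ≥0 := (-c).toNNReal with hcm
  obtain ⟨gs', hpre, hgood, hlen, hall⟩ := iterate_extend
    (Q := fun l gs' =>
      (∃ u : Operand ℝ≥0 (Fin n), u.RefsBelow gs'.length ∧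
        u.eval (gateValues gs') = C cp * a₁ l + C cm * b₁ l) ∧
      (∃ u : Operand ℝ≥0 (Fin n), u.RefsBelow gs'.length ∧
        u.eval (gateValues gs') = C cp * qa₁ l + C cm * qb₁ l) ∧
      (∃ u : Operand ℝ≥0 (Fin n), u.RefsBelow gs'.length ∧
        u.eval (gateValues gs') = C cp * b₁ l + C cm * a₁ l) ∧
      (∃ u : Operand ℝ≥0 (Fin n), u.RefsBelow gs'.length ∧
        u.eval (gateValues gs') = C cp * qb₁ l + C cm * qa₁ l))
    (fun l gs₁ gs₂ h hQ => ⟨avail_mono h hQ.1, avail_mono h hQ.2.1, avail_mono h hQ.2.2.1,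
      avail_mono h hQ.2.2.2⟩)
    12 gs hgs (d + 1) (by
      intro l hl gs' hp hg _
      obtain ⟨e1, e2, -, e4, e5, -, -⟩ := h₁ l (by omega)
      -- eight scalar multiplications
      obtain ⟨gs₁, hp₁, hg₁, hl₁, hz₁⟩ := avail_zipWith (· * ·) (fun gs p q => extend_mul)
        [C cp, C cp, C cp, C cp, C cm, C cm, C cm, C cm]
        [a₁ l, qa₁ l, b₁ l, qb₁ l, b₁ l, qb₁ l, a₁ l, qa₁ l] gs' hg
        (by
          intro p hp'
          simp only [List.mem_cons, List.not_mem_nil, or_false] at hp'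
          rcases hp' with rfl | rfl | rfl | rfl | rfl | rfl | rfl | rfl <;> exact avail_C gs' _)
        (by
          intro p hp'
          simp only [List.mem_cons, List.not_mem_nil, or_false] at hp'
          rcases hp' with rfl | rfl | rfl | rfl | rfl | rfl | rfl | rfl
          · exact avail_mono hp e1
          · exact avail_mono hp e2
          · exact avail_mono hp e4
          · exact avail_mono hp e5
          · exact avail_mono hp e4
          · exact avail_mono hp e5
          · exact avail_mono hp e1
          · exact avail_mono hp e2)
      -- four additions
      obtain ⟨gs₂, hp₂, hg₂, hl₂, hz₂⟩ := avail_zipWith (· + ·) (fun gs p q => extend_add)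
        [C cp * a₁ l, C cp * qa₁ l, C cp * b₁ l, C cp * qb₁ l]
        [C cm * b₁ l, C cm * qb₁ l, C cm * a₁ l, C cm * qa₁ l] gs₁ hg₁
        (by
          intro p hp'
          simp only [List.mem_cons, List.not_mem_nil, or_false] at hp'
          rcases hp' with rfl | rfl | rfl | rfl <;> exact hz₁ _ (by simp))
        (by
          intro p hp'
          simp only [List.mem_cons, List.not_mem_nil, or_false] at hp'
          rcases hp' with rfl | rfl | rfl | rfl <;> exact hz₁ _ (by simp))
      refine ⟨gs₂, hp₁.trans hp₂, hg₂, ?_, hz₂ _ (by simp), hz₂ _ (by simp), hz₂ _ (by simp),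
        hz₂ _ (by simp)⟩
      simp only [List.length_cons, List.length_nil] at hl₁ hl₂
      omega)
  refine ⟨gs', hpre, hgood, hlen, fun k => C cp * a₁ k + C cm * b₁ k,
    fun k => C cp * qa₁ k + C cm * qb₁ k, fun k => C cp * b₁ k + C cm * a₁ k,
    fun k => C cp * qb₁ k + C cm * qa₁ k, fun k => cp * A₁ k + cm * B₁ k,
    fun k => cp * B₁ k + cm * A₁ k, fun k hk => ?_⟩
  obtain ⟨-, -, e3, -, -, e6, e7⟩ := h₁ k hk
  obtain ⟨g1, g2, g4, g5⟩ := hall k (by omega)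
  have s3 := compl_smul_eq (C cp) e3
  have s6 := compl_smul_eq (C cm) e6
  have t3 := compl_smul_eq (C cm) e3
  have t6 := compl_smul_eq (C cp) e6
  refine ⟨g1, g2, ?_, g4, g5, ?_, ?_⟩
  · calc C cp * qa₁ k + C cm * qb₁ k + (C cp * a₁ k + C cm * b₁ k)
          = (C cp * qa₁ k + C cp * a₁ k) + (C cm * qb₁ k + C cm * b₁ k) := by ring
      _ = C (cp * A₁ k + cm * B₁ k) * (∑ i, X i) ^ k := by
          rw [s3, s6, map_add, map_mul, map_mul]; ring
  · calc C cp * qb₁ k + C cm * qa₁ k + (C cp * b₁ k + C cm * a₁ k)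
          = (C cp * qb₁ k + C cp * b₁ k) + (C cm * qa₁ k + C cm * a₁ k) := by ring
      _ = C (cp * B₁ k + cm * A₁ k) * (∑ i, X i) ^ k := by
          rw [t6, t3, map_add, map_mul, map_mul]; ring
  · rw [map_smul, e7, smul_eq_C_mul, ← max_zero_sub_max_neg_zero_eq_self c, C_sub]
    simp only [map_add, map_mul, map_C, NNReal.coe_toRealHom, hcp, hcm, Real.coe_toNNReal']
    ring

/-- Product gates (Lemma 23 (ii): the homogeneous parts of a product are the Cauchy products
`(vw)^{(k)} = Σ_l v^{(l)} w^{(k-l)}`, sign-split as `(a₁-b₁)(a₂-b₂) = (a₁a₂+b₁b₂) - (a₁b₂+b₁a₂)`;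
Lemma 22 eq. (5) for each product and eq. (4) for the sums): `32 (d+1)²` gates, using the
precomputed powers `L^j`, `j ≤ d` (Lemma 22 (ii)).
[cite: Hrubes2020, §4 Lemma 22 (eq. (5)) and Lemma 23 (ii)] -/
theorem repr_mul {gs : List (Gate ℝ≥0 (Fin n))} (hgs : ∀ g ∈ gs, g.fanIn ≤ 2 ∧ IsPlainGate g)
    {d : ℕ}
    (hL : ∀ j ≤ d, ∃ u : Operand ℝ≥0 (Fin n), u.RefsBelow gs.length ∧
      u.eval (gateValues gs) = (∑ i, X i) ^ j)
    {v w : MvPolynomial (Fin n) ℝ}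
    (hv : ∃ (a qa b qb : ℕ → MvPolynomial (Fin n) ℝ≥0) (A B : ℕ → ℝ≥0), ∀ k ≤ d,
      (∃ u : Operand ℝ≥0 (Fin n), u.RefsBelow gs.length ∧ u.eval (gateValues gs) = a k) ∧
      (∃ u : Operand ℝ≥0 (Fin n), u.RefsBelow gs.length ∧ u.eval (gateValues gs) = qa k) ∧
      qa k + a k = C (A k) * (∑ i, X i) ^ k ∧
      (∃ u : Operand ℝ≥0 (Fin n), u.RefsBelow gs.length ∧ u.eval (gateValues gs) = b k) ∧
      (∃ u : Operand ℝ≥0 (Fin n), u.RefsBelow gs.length ∧ u.eval (gateValues gs) = qb k) ∧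
      qb k + b k = C (B k) * (∑ i, X i) ^ k ∧
      homogeneousComponent k v = map NNReal.toRealHom (a k) - map NNReal.toRealHom (b k))
    (hw : ∃ (a qa b qb : ℕ → MvPolynomial (Fin n) ℝ≥0) (A B : ℕ → ℝ≥0), ∀ k ≤ d,
      (∃ u : Operand ℝ≥0 (Fin n), u.RefsBelow gs.length ∧ u.eval (gateValues gs) = a k) ∧
      (∃ u : Operand ℝ≥0 (Fin n), u.RefsBelow gs.length ∧ u.eval (gateValues gs) = qa k) ∧
      qa k + a k = C (A k) * (∑ i, X i) ^ k ∧
      (∃ u : Operand ℝ≥0 (Fin n), u.RefsBelow gs.length ∧ u.eval (gateValues gs) = b k) ∧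
      (∃ u : Operand ℝ≥0 (Fin n), u.RefsBelow gs.length ∧ u.eval (gateValues gs) = qb k) ∧
      qb k + b k = C (B k) * (∑ i, X i) ^ k ∧
      homogeneousComponent k w = map NNReal.toRealHom (a k) - map NNReal.toRealHom (b k)) :
    ∃ gs' : List (Gate ℝ≥0 (Fin n)), gs <+: gs' ∧ (∀ g ∈ gs', g.fanIn ≤ 2 ∧ IsPlainGate g) ∧
      gs'.length ≤ gs.length + 32 * (d + 1) ^ 2 ∧
    ∃ (a qa b qb : ℕ → MvPolynomial (Fin n) ℝ≥0) (A B : ℕ → ℝ≥0), ∀ k ≤ d,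
      (∃ u : Operand ℝ≥0 (Fin n), u.RefsBelow gs'.length ∧ u.eval (gateValues gs') = a k) ∧
      (∃ u : Operand ℝ≥0 (Fin n), u.RefsBelow gs'.length ∧ u.eval (gateValues gs') = qa k) ∧
      qa k + a k = C (A k) * (∑ i, X i) ^ k ∧
      (∃ u : Operand ℝ≥0 (Fin n), u.RefsBelow gs'.length ∧ u.eval (gateValues gs') = b k) ∧
      (∃ u : Operand ℝ≥0 (Fin n), u.RefsBelow gs'.length ∧ u.eval (gateValues gs') = qb k) ∧
      qb k + b k = C (B k) * (∑ i, X i) ^ k ∧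
      homogeneousComponent k (v * w) =
        map NNReal.toRealHom (a k) - map NNReal.toRealHom (b k) := by
  obtain ⟨a₁, qa₁, b₁, qb₁, A₁, B₁, h₁⟩ := hv
  obtain ⟨a₂, qa₂, b₂, qb₂, A₂, B₂, h₂⟩ := hw
  -- the four new families, level `k`, as functions of the summation index `l`
  set ta : ℕ → ℕ → MvPolynomial (Fin n) ℝ≥0 :=
    fun k l => a₁ l * a₂ (k - l) + b₁ l * b₂ (k - l) with hta
  set tqa : ℕ → ℕ → MvPolynomial (Fin n) ℝ≥0 := fun k l =>
    (qa₁ l * (C (A₂ (k - l)) * (∑ i, X i) ^ (k - l)) + a₁ l * qa₂ (k - l)) +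
      (qb₁ l * (C (B₂ (k - l)) * (∑ i, X i) ^ (k - l)) + b₁ l * qb₂ (k - l)) with htqa
  set tb : ℕ → ℕ → MvPolynomial (Fin n) ℝ≥0 :=
    fun k l => a₁ l * b₂ (k - l) + b₁ l * a₂ (k - l) with htb
  set tqb : ℕ → ℕ → MvPolynomial (Fin n) ℝ≥0 := fun k l =>
    (qa₁ l * (C (B₂ (k - l)) * (∑ i, X i) ^ (k - l)) + a₁ l * qb₂ (k - l)) +
      (qb₁ l * (C (A₂ (k - l)) * (∑ i, X i) ^ (k - l)) + b₁ l * qa₂ (k - l)) with htqb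
  obtain ⟨gs', hpre, hgood, hlen, hall⟩ := iterate_extend
    (Q := fun k gs' =>
      (∃ u : Operand ℝ≥0 (Fin n), u.RefsBelow gs'.length ∧
        u.eval (gateValues gs') = ∑ l ∈ Finset.range (k + 1), ta k l) ∧
      (∃ u : Operand ℝ≥0 (Fin n), u.RefsBelow gs'.length ∧
        u.eval (gateValues gs') = ∑ l ∈ Finset.range (k + 1), tqa k l) ∧
      (∃ u : Operand ℝ≥0 (Fin n), u.RefsBelow gs'.length ∧
        u.eval (gateValues gs') = ∑ l ∈ Finset.range (k + 1), tb k l) ∧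
      (∃ u : Operand ℝ≥0 (Fin n), u.RefsBelow gs'.length ∧
        u.eval (gateValues gs') = ∑ l ∈ Finset.range (k + 1), tqb k l))
    (fun l gs₁ gs₂ h hQ => ⟨avail_mono h hQ.1, avail_mono h hQ.2.1, avail_mono h hQ.2.2.1,
      avail_mono h hQ.2.2.2⟩)
    (32 * (d + 1)) gs hgs (d + 1) (by
      intro k hk gs' hp hg _
      -- (i) the positive part `a k`
      obtain ⟨gs₁, hp₁, hg₁, hl₁, hu₁⟩ := avail_sum_range (ta k) 3 gs' hg (k + 1) (by
        intro l hl gs'' hp'' hg''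
        have hp₀ : gs <+: gs'' := hp.trans hp''
        obtain ⟨e1, -, -, e4, -, -, -⟩ := h₁ l (by omega)
        obtain ⟨f1, -, -, f4, -, -, -⟩ := h₂ (k - l) (by omega)
        obtain ⟨gsa, hpa, hga, hla, hua⟩ :=
          extend_mul hg'' (avail_mono hp₀ e1) (avail_mono hp₀ f1)
        obtain ⟨gsb, hpb, hgb, hlb, hub⟩ :=
          extend_mul hga (avail_mono (hp₀.trans hpa) e4) (avail_mono (hp₀.trans hpa) f4)
        obtain ⟨gsc, hpc, hgc, hlc, huc⟩ := extend_add hgb (avail_mono hpb hua) hub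
        exact ⟨gsc, hpa.trans (hpb.trans hpc), hgc, by omega, huc⟩)
      -- (ii) its complement `qa k`
      obtain ⟨gs₂, hp₂, hg₂, hl₂, hu₂⟩ := avail_sum_range (tqa k) 11 gs₁ hg₁ (k + 1) (by
        intro l hl gs'' hp'' hg''
        have hp₀ : gs <+: gs'' := hp.trans (hp₁.trans hp'')
        obtain ⟨e1, e2, -, e4, e5, -, -⟩ := h₁ l (by omega)
        obtain ⟨f1, f2, -, f4, f5, -, -⟩ := h₂ (k - l) (by omega)
        have hLk := hL (k - l) (by omega)
        obtain ⟨gsa, hpa, hga, hla, -, hua⟩ := gadget_mul (A₂ (k - l)) hg'' (avail_mono hp₀ e1)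
          (avail_mono hp₀ e2) (avail_mono hp₀ f1) (avail_mono hp₀ f2) (avail_mono hp₀ hLk)
        have hp₀a := hp₀.trans hpa
        obtain ⟨gsb, hpb, hgb, hlb, -, hub⟩ := gadget_mul (B₂ (k - l)) hga (avail_mono hp₀a e4)
          (avail_mono hp₀a e5) (avail_mono hp₀a f4) (avail_mono hp₀a f5) (avail_mono hp₀a hLk)
        obtain ⟨gsc, hpc, hgc, hlc, huc⟩ := extend_add hgb (avail_mono hpb hua) hub
        exact ⟨gsc, hpa.trans (hpb.trans hpc), hgc, by omega, huc⟩)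
      -- (iii) the negative part `b k`
      obtain ⟨gs₃, hp₃, hg₃, hl₃, hu₃⟩ := avail_sum_range (tb k) 3 gs₂ hg₂ (k + 1) (by
        intro l hl gs'' hp'' hg''
        have hp₀ : gs <+: gs'' := hp.trans (hp₁.trans (hp₂.trans hp''))
        obtain ⟨e1, -, -, e4, -, -, -⟩ := h₁ l (by omega)
        obtain ⟨f1, -, -, f4, -, -, -⟩ := h₂ (k - l) (by omega)
        obtain ⟨gsa, hpa, hga, hla, hua⟩ :=
          extend_mul hg'' (avail_mono hp₀ e1) (avail_mono hp₀ f4)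
        obtain ⟨gsb, hpb, hgb, hlb, hub⟩ :=
          extend_mul hga (avail_mono (hp₀.trans hpa) e4) (avail_mono (hp₀.trans hpa) f1)
        obtain ⟨gsc, hpc, hgc, hlc, huc⟩ := extend_add hgb (avail_mono hpb hua) hub
        exact ⟨gsc, hpa.trans (hpb.trans hpc), hgc, by omega, huc⟩)
      -- (iv) its complement `qb k`
      obtain ⟨gs₄, hp₄, hg₄, hl₄, hu₄⟩ := avail_sum_range (tqb k) 11 gs₃ hg₃ (k + 1) (by
        intro l hl gs'' hp'' hg''
        have hp₀ : gs <+: gs'' := hp.trans (hp₁.trans (hp₂.trans (hp₃.trans hp'')))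
        obtain ⟨e1, e2, -, e4, e5, -, -⟩ := h₁ l (by omega)
        obtain ⟨f1, f2, -, f4, f5, -, -⟩ := h₂ (k - l) (by omega)
        have hLk := hL (k - l) (by omega)
        obtain ⟨gsa, hpa, hga, hla, -, hua⟩ := gadget_mul (B₂ (k - l)) hg'' (avail_mono hp₀ e1)
          (avail_mono hp₀ e2) (avail_mono hp₀ f4) (avail_mono hp₀ f5) (avail_mono hp₀ hLk)
        have hp₀a := hp₀.trans hpa
        obtain ⟨gsb, hpb, hgb, hlb, -, hub⟩ := gadget_mul (A₂ (k - l)) hga (avail_mono hp₀a e4)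
          (avail_mono hp₀a e5) (avail_mono hp₀a f1) (avail_mono hp₀a f2) (avail_mono hp₀a hLk)
        obtain ⟨gsc, hpc, hgc, hlc, huc⟩ := extend_add hgb (avail_mono hpb hua) hub
        exact ⟨gsc, hpa.trans (hpb.trans hpc), hgc, by omega, huc⟩)
      refine ⟨gs₄, hp₁.trans (hp₂.trans (hp₃.trans hp₄)), hg₄, ?_,
        avail_mono (hp₂.trans (hp₃.trans hp₄)) hu₁, avail_mono (hp₃.trans hp₄) hu₂,
        avail_mono hp₄ hu₃, hu₄⟩
      have hk1 : k + 1 ≤ d + 1 := by omega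
      have := Nat.mul_le_mul_left 32 hk1
      omega)
  refine ⟨gs', hpre, hgood, ?_, fun k => ∑ l ∈ Finset.range (k + 1), ta k l,
    fun k => ∑ l ∈ Finset.range (k + 1), tqa k l, fun k => ∑ l ∈ Finset.range (k + 1), tb k l,
    fun k => ∑ l ∈ Finset.range (k + 1), tqb k l,
    fun k => ∑ l ∈ Finset.range (k + 1), (A₁ l * A₂ (k - l) + B₁ l * B₂ (k - l)),
    fun k => ∑ l ∈ Finset.range (k + 1), (A₁ l * B₂ (k - l) + B₁ l * A₂ (k - l)),
    fun k hk => ?_⟩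
  · have : 32 * (d + 1) ^ 2 = 32 * (d + 1) * (d + 1) := by ring
    omega
  obtain ⟨g1, g2, g4, g5⟩ := hall k (by omega)
  refine ⟨g1, g2, ?_, g4, g5, ?_, ?_⟩
  · have key : ∀ l ∈ Finset.range (k + 1), tqa k l + ta k l =
        C (A₁ l * A₂ (k - l) + B₁ l * B₂ (k - l)) * (∑ i, X i) ^ k := by
      intro l hl
      rw [Finset.mem_range] at hl
      obtain ⟨-, -, e3, -, -, e6, -⟩ := h₁ l (by omega)
      obtain ⟨-, -, f3, -, -, f6, -⟩ := h₂ (k - l) (by omega)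
      have m1 := compl_mul_eq e3 f3
      have m2 := compl_mul_eq e6 f6
      rw [show l + (k - l) = k by omega] at m1 m2
      rw [map_add, map_mul, map_mul]
      exact compl_add_eq m1 m2
    rw [← Finset.sum_add_distrib, Finset.sum_congr rfl key, ← Finset.sum_mul, ← map_sum]
  · have key : ∀ l ∈ Finset.range (k + 1), tqb k l + tb k l =
        C (A₁ l * B₂ (k - l) + B₁ l * A₂ (k - l)) * (∑ i, X i) ^ k := by
      intro l hl
      rw [Finset.mem_range] at hl
      obtain ⟨-, -, e3, -, -, e6, -⟩ := h₁ l (by omega)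
      obtain ⟨-, -, f3, -, -, f6, -⟩ := h₂ (k - l) (by omega)
      have m1 := compl_mul_eq e3 f6
      have m2 := compl_mul_eq e6 f3
      rw [show l + (k - l) = k by omega] at m1 m2
      rw [map_add, map_mul, map_mul]
      exact compl_add_eq m1 m2
    rw [← Finset.sum_add_distrib, Finset.sum_congr rfl key, ← Finset.sum_mul, ← map_sum]
  · rw [DepthReduction.homogeneousComponent_mul, map_sum, map_sum, ← Finset.sum_sub_distrib]
    refine Finset.sum_congr rfl fun l hl => ?_
    rw [Finset.mem_range] at hl
    obtain ⟨-, -, -, -, -, -, e7⟩ := h₁ l (by omega)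
    obtain ⟨-, -, -, -, -, -, f7⟩ := h₂ (k - l) (by omega)
    rw [e7, f7]
    simp only [hta, htb, map_add, map_mul]
    ring

end Representation

/-! ### The pass over the general circuit (Lemma 23 (i), gate by gate) -/

section Pass

variable {n : ℕ}

/-- The precomputed complements `L - x_i` persist under extension. [cite: Hrubes2020, §4 Lemma 22] -/
theorem complX_mono {gs gs' : List (Gate ℝ≥0 (Fin n))} (h : gs <+: gs')
    (hLm : ∀ i : Fin n, ∃ u : Operand ℝ≥0 (Fin n), u.RefsBelow gs.length ∧
      u.eval (gateValues gs) + X i = ∑ i', X i') :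
    ∀ i : Fin n, ∃ u : Operand ℝ≥0 (Fin n), u.RefsBelow gs'.length ∧
      u.eval (gateValues gs') + X i = ∑ i', X i' := by
  intro i
  obtain ⟨u, hu, e⟩ := hLm i
  exact ⟨u, refsBelow_mono h.length_le hu, by rw [operand_eval_of_prefix h hu]; exact e⟩

/-- Operands of the general circuit (variables, constants, references to earlier gate values,
junk references reading `0`) are represented for free once the earlier gate values are.
[cite: Hrubes2020, §4 Lemma 22] -/
theorem repr_operand (gs : List (Gate ℝ≥0 (Fin n))) (d : ℕ)
    (hLm : ∀ i : Fin n, ∃ u : Operand ℝ≥0 (Fin n), u.RefsBelow gs.length ∧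
      u.eval (gateValues gs) + X i = ∑ i', X i')
    (vals : List (MvPolynomial (Fin n) ℝ))
    (hvals : ∀ v ∈ vals,
      ∃ (a qa b qb : ℕ → MvPolynomial (Fin n) ℝ≥0) (A B : ℕ → ℝ≥0), ∀ k ≤ d,
      (∃ u : Operand ℝ≥0 (Fin n), u.RefsBelow gs.length ∧ u.eval (gateValues gs) = a k) ∧
      (∃ u : Operand ℝ≥0 (Fin n), u.RefsBelow gs.length ∧ u.eval (gateValues gs) = qa k) ∧
      qa k + a k = C (A k) * (∑ i, X i) ^ k ∧
      (∃ u : Operand ℝ≥0 (Fin n), u.RefsBelow gs.length ∧ u.eval (gateValues gs) = b k) ∧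
      (∃ u : Operand ℝ≥0 (Fin n), u.RefsBelow gs.length ∧ u.eval (gateValues gs) = qb k) ∧
      qb k + b k = C (B k) * (∑ i, X i) ^ k ∧
      homogeneousComponent k v = map NNReal.toRealHom (a k) - map NNReal.toRealHom (b k))
    (u : Operand ℝ (Fin n)) :
    ∃ (a qa b qb : ℕ → MvPolynomial (Fin n) ℝ≥0) (A B : ℕ → ℝ≥0), ∀ k ≤ d,
      (∃ u : Operand ℝ≥0 (Fin n), u.RefsBelow gs.length ∧ u.eval (gateValues gs) = a k) ∧
      (∃ u : Operand ℝ≥0 (Fin n), u.RefsBelow gs.length ∧ u.eval (gateValues gs) = qa k) ∧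
      qa k + a k = C (A k) * (∑ i, X i) ^ k ∧
      (∃ u : Operand ℝ≥0 (Fin n), u.RefsBelow gs.length ∧ u.eval (gateValues gs) = b k) ∧
      (∃ u : Operand ℝ≥0 (Fin n), u.RefsBelow gs.length ∧ u.eval (gateValues gs) = qb k) ∧
      qb k + b k = C (B k) * (∑ i, X i) ^ k ∧
      homogeneousComponent k (u.eval vals) =
        map NNReal.toRealHom (a k) - map NNReal.toRealHom (b k) := by
  cases u with
  | var i => exact repr_X gs d hLm i
  | const c => exact repr_C gs d c
  | gate j =>
    simp only [Operand.eval, List.getD_eq_getElem?_getD]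
    cases hj : vals[j]? with
    | none => exact repr_zero gs d
    | some v => exact hvals v (List.mem_of_getElem? hj)

/-- One gate of the general fan-in-two circuit over `ℝ` (a weighted sum `c u + e w` or a product
`u w` of at most two operands): `60 (d+1)²` monotone gates represent its value
(Lemma 23 (i)–(ii) with Lemma 22). [cite: Hrubes2020, §4 Lemma 23] -/
theorem repr_gate {gs : List (Gate ℝ≥0 (Fin n))} (hgs : ∀ g ∈ gs, g.fanIn ≤ 2 ∧ IsPlainGate g)
    {d : ℕ}
    (hL : ∀ j ≤ d, ∃ u : Operand ℝ≥0 (Fin n), u.RefsBelow gs.length ∧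
      u.eval (gateValues gs) = (∑ i, X i) ^ j)
    (hLm : ∀ i : Fin n, ∃ u : Operand ℝ≥0 (Fin n), u.RefsBelow gs.length ∧
      u.eval (gateValues gs) + X i = ∑ i', X i')
    (vals : List (MvPolynomial (Fin n) ℝ))
    (hvals : ∀ v ∈ vals,
      ∃ (a qa b qb : ℕ → MvPolynomial (Fin n) ℝ≥0) (A B : ℕ → ℝ≥0), ∀ k ≤ d,
      (∃ u : Operand ℝ≥0 (Fin n), u.RefsBelow gs.length ∧ u.eval (gateValues gs) = a k) ∧
      (∃ u : Operand ℝ≥0 (Fin n), u.RefsBelow gs.length ∧ u.eval (gateValues gs) = qa k) ∧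
      qa k + a k = C (A k) * (∑ i, X i) ^ k ∧
      (∃ u : Operand ℝ≥0 (Fin n), u.RefsBelow gs.length ∧ u.eval (gateValues gs) = b k) ∧
      (∃ u : Operand ℝ≥0 (Fin n), u.RefsBelow gs.length ∧ u.eval (gateValues gs) = qb k) ∧
      qb k + b k = C (B k) * (∑ i, X i) ^ k ∧
      homogeneousComponent k v = map NNReal.toRealHom (a k) - map NNReal.toRealHom (b k))
    (g : Gate ℝ (Fin n)) (hg : g.fanIn ≤ 2) :
    ∃ gs' : List (Gate ℝ≥0 (Fin n)), gs <+: gs' ∧ (∀ g ∈ gs', g.fanIn ≤ 2 ∧ IsPlainGate g) ∧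
      gs'.length ≤ gs.length + 60 * (d + 1) ^ 2 ∧
    ∃ (a qa b qb : ℕ → MvPolynomial (Fin n) ℝ≥0) (A B : ℕ → ℝ≥0), ∀ k ≤ d,
      (∃ u : Operand ℝ≥0 (Fin n), u.RefsBelow gs'.length ∧ u.eval (gateValues gs') = a k) ∧
      (∃ u : Operand ℝ≥0 (Fin n), u.RefsBelow gs'.length ∧ u.eval (gateValues gs') = qa k) ∧
      qa k + a k = C (A k) * (∑ i, X i) ^ k ∧
      (∃ u : Operand ℝ≥0 (Fin n), u.RefsBelow gs'.length ∧ u.eval (gateValues gs') = b k) ∧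
      (∃ u : Operand ℝ≥0 (Fin n), u.RefsBelow gs'.length ∧ u.eval (gateValues gs') = qb k) ∧
      qb k + b k = C (B k) * (∑ i, X i) ^ k ∧
      homogeneousComponent k (g.eval vals) =
        map NNReal.toRealHom (a k) - map NNReal.toRealHom (b k) := by
  have hsq : d + 1 ≤ (d + 1) ^ 2 := by rw [sq]; exact Nat.le_mul_self _
  cases g with
  | sum args =>
    match args, hg with
    | [], _ =>
      refine ⟨gs, List.prefix_rfl, hgs, by omega, ?_⟩
      have hval : (Gate.sum ([] : List (ℝ × Operand ℝ (Fin n)))).eval vals = 0 := by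
        simp [Gate.eval]
      rw [hval]
      exact repr_zero gs d
    | [a], _ =>
      obtain ⟨gs₁, hp₁, hg₁, hl₁, hr₁⟩ :=
        repr_smul hgs a.1 (repr_operand gs d hLm vals hvals a.2)
      refine ⟨gs₁, hp₁, hg₁, by nlinarith, ?_⟩
      have hval : (Gate.sum [a]).eval vals = a.1 • a.2.eval vals := by simp [Gate.eval]
      rw [hval]
      exact hr₁
    | [a, b], _ =>
      obtain ⟨gs₁, hp₁, hg₁, hl₁, hr₁⟩ :=
        repr_smul hgs a.1 (repr_operand gs d hLm vals hvals a.2)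
      obtain ⟨gs₂, hp₂, hg₂, hl₂, hr₂⟩ :=
        repr_smul hg₁ b.1 (repr_operand gs₁ d (complX_mono hp₁ hLm) vals
          (fun v hv => repr_mono hp₁ (hvals v hv)) b.2)
      obtain ⟨gs₃, hp₃, hg₃, hl₃, hr₃⟩ := repr_add hg₂ (repr_mono hp₂ hr₁) hr₂
      refine ⟨gs₃, hp₁.trans (hp₂.trans hp₃), hg₃, by nlinarith, ?_⟩
      have hval : (Gate.sum [a, b]).eval vals = a.1 • a.2.eval vals + b.1 • b.2.eval vals := by
        simp [Gate.eval]
      rw [hval]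
      exact hr₃
    | _ :: _ :: _ :: _, hg => simp [Gate.fanIn, Gate.args] at hg
  | prod args =>
    match args, hg with
    | [], _ =>
      refine ⟨gs, List.prefix_rfl, hgs, by omega, ?_⟩
      have hval : (Gate.prod ([] : List (Operand ℝ (Fin n)))).eval vals = C 1 := by
        simp [Gate.eval]
      rw [hval]
      exact repr_C gs d 1
    | [u], _ =>
      refine ⟨gs, List.prefix_rfl, hgs, by omega, ?_⟩
      have hval : (Gate.prod [u]).eval vals = u.eval vals := by simp [Gate.eval]
      rw [hval]
      exact repr_operand gs d hLm vals hvals u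
    | [u, w], _ =>
      obtain ⟨gs₁, hp₁, hg₁, hl₁, hr₁⟩ := repr_mul hgs hL (repr_operand gs d hLm vals hvals u)
        (repr_operand gs d hLm vals hvals w)
      refine ⟨gs₁, hp₁, hg₁, by nlinarith, ?_⟩
      have hval : (Gate.prod [u, w]).eval vals = u.eval vals * w.eval vals := by simp [Gate.eval]
      rw [hval]
      exact hr₁
    | _ :: _ :: _ :: _, hg => simp [Gate.fanIn, Gate.args] at hg

/-- The pass (Lemma 23 (i)–(ii) with Lemma 22, all gates): `60 (d+1)²` monotone gates per gate
of the general circuit represent all its gate values simultaneously.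
[cite: Hrubes2020, §4 Lemma 22 and Lemma 23] -/
theorem repr_gates {gs : List (Gate ℝ≥0 (Fin n))} (hgs : ∀ g ∈ gs, g.fanIn ≤ 2 ∧ IsPlainGate g)
    {d : ℕ}
    (hL : ∀ j ≤ d, ∃ u : Operand ℝ≥0 (Fin n), u.RefsBelow gs.length ∧
      u.eval (gateValues gs) = (∑ i, X i) ^ j)
    (hLm : ∀ i : Fin n, ∃ u : Operand ℝ≥0 (Fin n), u.RefsBelow gs.length ∧
      u.eval (gateValues gs) + X i = ∑ i', X i')
    (cs : List (Gate ℝ (Fin n))) (hcs : ∀ g ∈ cs, g.fanIn ≤ 2) :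
    ∃ gs' : List (Gate ℝ≥0 (Fin n)), gs <+: gs' ∧ (∀ g ∈ gs', g.fanIn ≤ 2 ∧ IsPlainGate g) ∧
      gs'.length ≤ gs.length + 60 * (d + 1) ^ 2 * cs.length ∧
    ∀ v ∈ gateValues cs,
    ∃ (a qa b qb : ℕ → MvPolynomial (Fin n) ℝ≥0) (A B : ℕ → ℝ≥0), ∀ k ≤ d,
      (∃ u : Operand ℝ≥0 (Fin n), u.RefsBelow gs'.length ∧ u.eval (gateValues gs') = a k) ∧
      (∃ u : Operand ℝ≥0 (Fin n), u.RefsBelow gs'.length ∧ u.eval (gateValues gs') = qa k) ∧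
      qa k + a k = C (A k) * (∑ i, X i) ^ k ∧
      (∃ u : Operand ℝ≥0 (Fin n), u.RefsBelow gs'.length ∧ u.eval (gateValues gs') = b k) ∧
      (∃ u : Operand ℝ≥0 (Fin n), u.RefsBelow gs'.length ∧ u.eval (gateValues gs') = qb k) ∧
      qb k + b k = C (B k) * (∑ i, X i) ^ k ∧
      homogeneousComponent k v = map NNReal.toRealHom (a k) - map NNReal.toRealHom (b k) := by
  induction cs using List.reverseRecOn with
  | nil =>
    exact ⟨gs, List.prefix_rfl, hgs, by simp, fun v hv => by simp [gateValues] at hv⟩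
  | append_singleton cs g ih =>
    obtain ⟨gs₁, hp₁, hg₁, hl₁, hr₁⟩ := ih fun g' hg' => hcs g' (by simp [hg'])
    obtain ⟨gs₂, hp₂, hg₂, hl₂, hr₂⟩ := repr_gate hg₁ (fun j hj => avail_mono hp₁ (hL j hj))
      (complX_mono hp₁ hLm) (gateValues cs) hr₁ g (hcs g (by simp))
    refine ⟨gs₂, hp₁.trans hp₂, hg₂, ?_, ?_⟩
    · simp only [List.length_append, List.length_singleton]
      rw [Nat.mul_succ]
      omega
    · intro v hv
      rw [gateValues_append_singleton, List.mem_append, List.mem_singleton] at hv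
      rcases hv with hv | rfl
      · exact repr_mono hp₂ (hr₁ v hv)
      · exact hr₂

end Pass

/-! ### Lemma 22 (i)–(ii): the inputs `L - x_j` (prefix and suffix sums) and the powers `L^k` -/

section Inputs

/-- The preprocessing: `3n + d` plain gates make available all powers `L^j`, `j ≤ d`, of
`L = Σ x_i` (Lemma 22 (ii)) and, for every variable `x_i`, its complement `Σ_{i' ≠ i} x_{i'}`
(Lemma 22 (i); print: "easily constructed recursively", `O(n log n)`; here prefix sums
`x_0 + ⋯ + x_{i-1}` plus suffix sums `x_{i+1} + ⋯ + x_{n-1}`, `O(n)`).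
[cite: Hrubes2020, §4 Lemma 22 (items (i), (ii))] -/
theorem pre_build (n d : ℕ) :
    ∃ gs : List (Gate ℝ≥0 (Fin n)), (∀ g ∈ gs, g.fanIn ≤ 2 ∧ IsPlainGate g) ∧
      gs.length ≤ 3 * n + d ∧
      (∀ j ≤ d, ∃ u : Operand ℝ≥0 (Fin n), u.RefsBelow gs.length ∧
        u.eval (gateValues gs) = (∑ i, X i) ^ j) ∧
      (∀ i : Fin n, ∃ u : Operand ℝ≥0 (Fin n), u.RefsBelow gs.length ∧
        u.eval (gateValues gs) + X i = ∑ i', X i') := by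
  set xs : List (MvPolynomial (Fin n) ℝ≥0) := List.ofFn fun i : Fin n => X i with hxs
  have hxl : xs.length = n := by simp [hxs]
  have hsum : xs.sum = ∑ i, X i := by simp [hxs, List.sum_ofFn]
  have hget : ∀ (l : ℕ) (hl : l < n) (hl' : l < xs.length), xs[l] = X ⟨l, hl⟩ := by
    intro l hl hl'
    simp [hxs, List.getElem_ofFn]
  have hgood0 : ∀ g ∈ ([] : List (Gate ℝ≥0 (Fin n))), g.fanIn ≤ 2 ∧ IsPlainGate g := by simp
  -- (1) prefix sums `x_0 + ⋯ + x_l`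
  obtain ⟨gs₁, -, hg₁, hl₁, hQ₁⟩ := iterate_extend
    (Q := fun l gs => ∃ u : Operand ℝ≥0 (Fin n), u.RefsBelow gs.length ∧
      u.eval (gateValues gs) = (xs.take (l + 1)).sum)
    (fun l gs₁ gs₂ h hQ => avail_mono h hQ) 1 [] hgood0 n (by
      intro l hl gs' _ hg' hprev
      have hprev' : ∃ u : Operand ℝ≥0 (Fin n), u.RefsBelow gs'.length ∧
          u.eval (gateValues gs') = (xs.take l).sum := by
        rcases Nat.eq_zero_or_pos l with rfl | hpos
        · simpa using avail_C gs' (0 : ℝ≥0)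
        · have := hprev (l - 1) (by omega)
          rwa [Nat.sub_add_cancel hpos] at this
      obtain ⟨gs'', hp'', hg'', hl'', hu⟩ := extend_add hg' hprev' (avail_X gs' ⟨l, hl⟩)
      refine ⟨gs'', hp'', hg'', hl'', ?_⟩
      have hlx : l < xs.length := by omega
      rw [List.take_succ_eq_append_getElem hlx, List.sum_append, List.sum_singleton,
        hget l hl hlx]
      exact hu)
  -- (2) suffix sums `x_{n-1-l} + ⋯ + x_{n-1}`
  obtain ⟨gs₂, hp₂, hg₂, hl₂, hQ₂⟩ := iterate_extend
    (Q := fun l gs => ∃ u : Operand ℝ≥0 (Fin n), u.RefsBelow gs.length ∧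
      u.eval (gateValues gs) = (xs.drop (n - 1 - l)).sum)
    (fun l gs₁ gs₂ h hQ => avail_mono h hQ) 1 gs₁ hg₁ n (by
      intro l hl gs' _ hg' hprev
      have hprev' : ∃ u : Operand ℝ≥0 (Fin n), u.RefsBelow gs'.length ∧
          u.eval (gateValues gs') = (xs.drop (n - l)).sum := by
        rcases Nat.eq_zero_or_pos l with rfl | hpos
        · have : xs.drop (n - 0) = [] := List.drop_eq_nil_of_le (by omega)
          rw [this]
          simpa using avail_C gs' (0 : ℝ≥0)
        · have := hprev (l - 1) (by omega)
          rwa [show n - 1 - (l - 1) = n - l by omega] at this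
      obtain ⟨gs'', hp'', hg'', hl'', hu⟩ :=
        extend_add hg' (avail_X gs' ⟨n - 1 - l, by omega⟩) hprev'
      refine ⟨gs'', hp'', hg'', hl'', ?_⟩
      have hlx : n - 1 - l < xs.length := by omega
      rw [List.drop_eq_getElem_cons hlx, List.sum_cons, hget (n - 1 - l) (by omega) hlx,
        show n - 1 - l + 1 = n - l by omega]
      exact hu)
  -- (3) the complements `L - x_l = (x_0 + ⋯ + x_{l-1}) + (x_{l+1} + ⋯ + x_{n-1})`
  obtain ⟨gs₃, hp₃, hg₃, hl₃, hQ₃⟩ := iterate_extend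
    (Q := fun l gs => ∀ hl : l < n, ∃ u : Operand ℝ≥0 (Fin n), u.RefsBelow gs.length ∧
      u.eval (gateValues gs) + X ⟨l, hl⟩ = ∑ i, X i)
    (fun l gs₁ gs₂ h hQ hl => by
      obtain ⟨u, hu, e⟩ := hQ hl
      exact ⟨u, refsBelow_mono h.length_le hu, by rw [operand_eval_of_prefix h hu]; exact e⟩)
    1 gs₂ hg₂ n (by
      intro l hl gs' hp' hg' _
      have hpref : ∃ u : Operand ℝ≥0 (Fin n), u.RefsBelow gs'.length ∧
          u.eval (gateValues gs') = (xs.take l).sum := by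
        rcases Nat.eq_zero_or_pos l with rfl | hpos
        · simpa using avail_C gs' (0 : ℝ≥0)
        · have := hQ₁ (l - 1) (by omega)
          rw [Nat.sub_add_cancel hpos] at this
          exact avail_mono (hp₂.trans hp') this
      have hsuf : ∃ u : Operand ℝ≥0 (Fin n), u.RefsBelow gs'.length ∧
          u.eval (gateValues gs') = (xs.drop (l + 1)).sum := by
        by_cases hln : l + 1 = n
        · have : xs.drop (l + 1) = [] := List.drop_eq_nil_of_le (by omega)
          rw [this]
          simpa using avail_C gs' (0 : ℝ≥0)
        · have := hQ₂ (n - 1 - (l + 1)) (by omega)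
          rw [show n - 1 - (n - 1 - (l + 1)) = l + 1 by omega] at this
          exact avail_mono hp' this
      obtain ⟨gs'', hp'', hg'', hl'', u, hu, hue⟩ := extend_add hg' hpref hsuf
      refine ⟨gs'', hp'', hg'', hl'', fun hl' => ⟨u, hu, ?_⟩⟩
      rw [hue]
      have hlx : l < xs.length := by omega
      calc (xs.take l).sum + (xs.drop (l + 1)).sum + X ⟨l, hl'⟩
          = (xs.take l).sum + (xs[l] + (xs.drop (l + 1)).sum) := by rw [hget l hl' hlx]; ring
        _ = (xs.take l).sum + (xs.drop l).sum := by rw [List.drop_eq_getElem_cons hlx, List.sum_cons]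
        _ = xs.sum := by rw [← List.sum_append, List.take_append_drop]
        _ = ∑ i, X i := hsum)
  -- (4) the powers `L^{j+1}`, `j < d`
  have hL1 : ∃ u : Operand ℝ≥0 (Fin n), u.RefsBelow gs₃.length ∧
      u.eval (gateValues gs₃) = ∑ i, X i := by
    rcases Nat.eq_zero_or_pos n with hn | hpos
    · subst hn
      simpa using avail_C gs₃ (0 : ℝ≥0)
    · have := hQ₁ (n - 1) (by omega)
      rw [Nat.sub_add_cancel hpos, List.take_of_length_le (le_of_eq hxl), hsum] at this
      exact avail_mono (hp₂.trans hp₃) this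
  obtain ⟨gs₄, hp₄, hg₄, hl₄, hQ₄⟩ := iterate_extend
    (Q := fun j gs => ∃ u : Operand ℝ≥0 (Fin n), u.RefsBelow gs.length ∧
      u.eval (gateValues gs) = (∑ i, X i) ^ (j + 1))
    (fun l gs₁ gs₂ h hQ => avail_mono h hQ) 1 gs₃ hg₃ d (by
      intro j hj gs' hp' hg' hprev
      have hprev' : ∃ u : Operand ℝ≥0 (Fin n), u.RefsBelow gs'.length ∧
          u.eval (gateValues gs') = (∑ i, X i) ^ j := by
        rcases Nat.eq_zero_or_pos j with rfl | hpos
        · simpa using avail_C gs' (1 : ℝ≥0)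
        · have := hprev (j - 1) (by omega)
          rwa [Nat.sub_add_cancel hpos] at this
      obtain ⟨gs'', hp'', hg'', hl'', hu⟩ := extend_mul hg' hprev' (avail_mono hp' hL1)
      exact ⟨gs'', hp'', hg'', hl'', by rwa [pow_succ]⟩)
  refine ⟨gs₄, hg₄, ?_, ?_, ?_⟩
  · simp only [List.length_nil] at hl₁
    omega
  · intro j hj
    rcases Nat.eq_zero_or_pos j with rfl | hpos
    · simpa using avail_C gs₄ (1 : ℝ≥0)
    · have := hQ₄ (j - 1) (by omega)
      rwa [Nat.sub_add_cancel hpos] at this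
  · intro i
    obtain ⟨u, hu, e⟩ := hQ₃ i.val i.isLt i.isLt
    exact ⟨u, refsBelow_mono hp₄.length_le hu, by rw [operand_eval_of_prefix hp₄ hu]; exact e⟩

end Inputs

end Hrubes2020

/-! ### Theorem 1 -/

open Hrubes2020 in
/-- **Hrubeš 2020, Theorem 1** (discharge of `Hrubes2020_sensitive`): if `f ∈ ℝ[x_1,…,x_n]` has
degree `d` and fan-in-two circuit complexity `s`, then for all `0 < ε < ε₀` the polynomial
`(1 + Σ x_i)^d + ε f` is computed by a plain fan-in-two circuit over `ℝ≥0` (a Jerrum–Snir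
monotone computation) of size `≤ 1000 (s d² + n ⌊log₂ n⌋ + 1)`. Proof as printed in §4:
`f = f₊ - f₋` degree by degree along the circuit (Lemma 23), complements
`R_k L^k - f₋^{(k)}` (Lemma 22), and `R (L+1)^d + f = f₊ + Σ_k ((R·C(d,k) - R_k) L^k +
(R_k L^k - f₋^{(k)}))` with `ε₀ = (R+1)⁻¹`, `R = Σ_k R_k`; scaling by `ε` gives the statement.
[cite: Hrubes2020, Thm 1 (§4, "Theorem 1 (restated)", proof)] -/
theorem Hrubes2020_sensitive_holds : Hrubes2020_sensitive := by
  refine ⟨1000, fun n d f hfd => ?_⟩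
  -- a size-optimal fan-in-two circuit for `f`
  obtain ⟨P, hP2, hPf, hPs⟩ := ArithCircuit.exists_computes_size_eq_complexity f
  -- preprocessing and the pass
  obtain ⟨gs₀, hg₀, hl₀, hL₀, hLm₀⟩ := pre_build n d
  obtain ⟨gs₁, hp₁, hg₁, hl₁, hr₁⟩ := repr_gates hg₀ hL₀ hLm₀ P.gates hP2
  -- the output of `P`
  have hrf := repr_operand gs₁ d (complX_mono hp₁ hLm₀) (gateValues P.gates) hr₁ P.output
  rw [show P.output.eval (gateValues P.gates) = f from hPf] at hrf
  obtain ⟨a, qa, b, qb, A, B, hk⟩ := hrf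
  -- `ε₀ := (R + 1)⁻¹`, `R := Σ_k B_k`
  set R : ℝ≥0 := ∑ k ∈ Finset.range (d + 1), B k with hR
  refine ⟨((R : ℝ) + 1)⁻¹, by positivity, fun ε hε hεR => ?_⟩
  set ε' : ℝ≥0 := ε.toNNReal with hε'
  have hε'c : (ε' : ℝ) = ε := Real.coe_toNNReal ε hε.le
  have hεR1 : ε * ((R : ℝ) + 1) < 1 := by
    have hpos : (0 : ℝ) < (R : ℝ) + 1 := by positivity
    have := mul_lt_mul_of_pos_right hεR hpos
    rwa [inv_mul_cancel₀ hpos.ne'] at this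
  have hsmall : ∀ k ≤ d, ε' * B k ≤ (d.choose k : ℝ≥0) := by
    intro k hk'
    have hBR : B k ≤ R :=
      Finset.single_le_sum (f := B) (fun _ _ => zero_le) (Finset.mem_range.mpr (by omega))
    have h1 : (1 : ℝ≥0) ≤ (d.choose k : ℝ≥0) := by exact_mod_cast Nat.choose_pos hk'
    refine le_trans ?_ h1
    rw [← NNReal.coe_le_coe, NNReal.coe_mul, hε'c, NNReal.coe_one]
    have hBR' : ((B k : ℝ≥0) : ℝ) ≤ R := NNReal.coe_le_coe.mpr hBR
    have hB0 : (0 : ℝ) ≤ B k := (B k).coe_nonneg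
    nlinarith
  -- the monotone polynomial `g` and its circuit
  obtain ⟨gs₂, hp₂, hg₂, hl₂, uo, huo, hue⟩ := avail_sum_range
    (fun k => C ((d.choose k : ℝ≥0) - ε' * B k) * (∑ i, X i) ^ k + C ε' * qb k + C ε' * a k)
    5 gs₁ hg₁ (d + 1) (by
      intro k hk' gs' hp' hg'
      obtain ⟨e1, -, -, -, e5, -, -⟩ := hk k (by omega)
      have hLk := avail_mono (hp₁.trans hp') (hL₀ k (by omega))
      obtain ⟨gsa, hpa, hga, hla, hua⟩ := extend_smul ((d.choose k : ℝ≥0) - ε' * B k) hg' hLk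
      obtain ⟨gsb, hpb, hgb, hlb, hub⟩ := extend_smul ε' hga (avail_mono (hp'.trans hpa) e5)
      obtain ⟨gsc, hpc, hgc, hlc, huc⟩ :=
        extend_smul ε' hgb (avail_mono (hp'.trans (hpa.trans hpb)) e1)
      obtain ⟨gsd, hpd, hgd, hld, hud⟩ :=
        extend_add hgc (avail_mono (hpb.trans hpc) hua) (avail_mono hpc hub)
      obtain ⟨gse, hpe, hge, hle, hue⟩ := extend_add hgd hud (avail_mono hpd huc)
      exact ⟨gse, hpa.trans (hpb.trans (hpc.trans (hpd.trans hpe))), hge, by omega, hue⟩)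
  refine ⟨∑ k ∈ Finset.range (d + 1),
      (C ((d.choose k : ℝ≥0) - ε' * B k) * (∑ i, X i) ^ k + C ε' * qb k + C ε' * a k),
    ⟨gs₂, uo⟩, ?_, ⟨fun g hg => (hg₂ g hg).1, fun g hg => (hg₂ g hg).2, hue⟩, ?_⟩
  · -- `map ι g = (1 + L)^d + ε f`
    have hmapL : MvPolynomial.map NNReal.toRealHom (∑ i, X i : MvPolynomial (Fin n) ℝ≥0) =
        ∑ i, X i := by
      simp
    have hterm : ∀ k ∈ Finset.range (d + 1),
        MvPolynomial.map NNReal.toRealHom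
          (C ((d.choose k : ℝ≥0) - ε' * B k) * (∑ i, X i) ^ k + C ε' * qb k + C ε' * a k) =
        (d.choose k : MvPolynomial (Fin n) ℝ) * (∑ i, X i) ^ k +
          C ε * homogeneousComponent k f := by
      intro k hk'
      rw [Finset.mem_range] at hk'
      obtain ⟨-, -, -, -, -, e6, e7⟩ := hk k (by omega)
      have e6' : MvPolynomial.map NNReal.toRealHom (qb k) =
          C ((B k : ℝ≥0) : ℝ) * (∑ i, X i) ^ k - MvPolynomial.map NNReal.toRealHom (b k) := by
        have := congrArg (MvPolynomial.map NNReal.toRealHom) e6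
        simp only [map_add, map_mul, map_C, map_pow, hmapL, NNReal.coe_toRealHom] at this
        linear_combination this
      have hc : (((d.choose k : ℝ≥0) - ε' * B k : ℝ≥0) : ℝ) = (d.choose k : ℝ) - ε * B k := by
        rw [NNReal.coe_sub (hsmall k (by omega)), NNReal.coe_mul, hε'c, NNReal.coe_natCast]
      rw [map_add, map_add, map_mul, map_mul, map_mul, map_pow, hmapL, map_C, map_C, e6', e7,
        NNReal.coe_toRealHom, hc, hε'c, C_sub, C_mul, map_natCast]
      ring
    rw [map_sum, Finset.sum_congr rfl hterm, Finset.sum_add_distrib, ← Finset.mul_sum, ← hfd,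
      sum_homogeneousComponent, add_comm (1 : MvPolynomial (Fin n) ℝ), add_pow]
    congr 1
    refine Finset.sum_congr rfl fun k _ => ?_
    rw [one_pow, mul_one, mul_comm]
  · -- the size bound
    show gs₂.length ≤ 1000 * (complexity f * d ^ 2 + n * Nat.log 2 n + 1)
    have hsz : P.gates.length = complexity f := hPs
    have f1 : n ≤ n * Nat.log 2 n + 1 := by
      rcases Nat.lt_or_ge n 2 with h | h
      · omega
      · have : 0 < Nat.log 2 n := Nat.log_pos (by norm_num) h
        nlinarith
    have f2 : d = 0 → complexity f = 0 := fun hd => by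
      have hf0 : f.totalDegree = 0 := hfd.trans hd
      rw [totalDegree_eq_zero_iff_eq_C] at hf0
      rw [hf0]
      exact complexity_C_holds _
    have f3 : complexity f = 0 → d ≤ 1 := fun hs0 => by
      have hnil : P.gates = [] := List.eq_nil_of_length_eq_zero (hsz.trans hs0)
      have hfe : f = P.output.eval [] := by
        rw [← hPf]
        show P.output.eval (gateValues P.gates) = _
        rw [hnil]
        rfl
      rw [← hfd, hfe]
      cases P.output with
      | var i => exact (totalDegree_X (R := ℝ) i).le
      | const c => simp [Operand.eval]
      | gate j => simp [Operand.eval]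
    have key : gs₂.length ≤ 3 * n + 7 * d + 6 + 60 * ((d + 1) ^ 2 * complexity f) := by
      rw [hsz] at hl₁
      have : 60 * (d + 1) ^ 2 * complexity f = 60 * ((d + 1) ^ 2 * complexity f) := by ring
      have h6 : (5 + 1) * (d + 1) = 6 * d + 6 := by ring
      omega
    have i1 : 60 * ((d + 1) ^ 2 * complexity f) ≤ 240 * (complexity f * d ^ 2) := by
      rcases Nat.eq_zero_or_pos d with hd | hd
      · rw [f2 hd]; simp
      · have hdd : d ≤ d * d := Nat.le_mul_self d
        have h4 : (d + 1) ^ 2 ≤ 4 * d ^ 2 := by nlinarith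
        calc 60 * ((d + 1) ^ 2 * complexity f) ≤ 60 * (4 * d ^ 2 * complexity f) := by gcongr
          _ = 240 * (complexity f * d ^ 2) := by ring
    have i3 : 7 * d + 6 ≤ 7 * (complexity f * d ^ 2) + 13 := by
      rcases Nat.eq_zero_or_pos (complexity f) with hs0 | hs0
      · have := f3 hs0
        omega
      · have hdd : d ≤ d ^ 2 := by rw [sq]; exact Nat.le_mul_self d
        have : d ^ 2 ≤ complexity f * d ^ 2 := Nat.le_mul_of_pos_left _ hs0
        omega
    generalize (d + 1) ^ 2 * complexity f = U at key i1
    generalize complexity f * d ^ 2 = T at i1 i3 ⊢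
    generalize n * Nat.log 2 n = N at f1 ⊢
    omega

end Literature.Computability.AlgebraicComplexity

end
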